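import Summits.KontsevichZagierPeriods.KontsevichZagierPeriods.Theses.LiftingCriteria
import Mathlib.Algebra.MvPolynomial.PDeriv
import Summits.KontsevichZagierPeriods.KontsevichZagierPeriods.Theorems.LiftingCriteriaDilationLiftAtOneSingleGenerator
import Summits.KontsevichZagierPeriods.KontsevichZagierPeriods.Theorems.LiftingCriteriaDilationLiftAtOneLocalPurityAtOne
import Summits.KontsevichZagierPeriods.KontsevichZagierPeriods.Theorems.LiftingCriteriaDilationLiftAtOneTwistedDiagonal
import Summits.KontsevichZagierPeriods.KontsevichZagierPeriods.Theorems.LiftingCriteriaDilationLiftAtOneBakerSector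
import Summits.KontsevichZagierPeriods.KontsevichZagierPeriods.Theorems.LiftingCriteriaDilationLiftAtOneBakerSectorComplex
import Summits.KontsevichZagierPeriods.KontsevichZagierPeriods.Theorems.LiftingCriteriaDilationLiftAtOneDimOneRational
import Summits.KontsevichZagierPeriods.KontsevichZagierPeriods.Theorems.LiftingCriteriaDilationLiftAtOneDimTwoStokes

/-!
# `DilationLiftAtOne` (stmt-KontsevichZagierPeriods-3571, route LiftingCriteria, rank 2) — line `registered` (birth skeleton), lead c1

Wave 1 (2026-08-17): S1 `stub_singleGenerator`, S2 `stub_localPurityAtOne`, S4 `stub_twistedDiagonal`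
landed as `--supports` files (imported below); open: S3 `stub_glueAtOne` only.
Lead c2 (2026-08-17): RESHAPE — S3′ `stub_bakerSectorReal` (real Baker sector of the glue, unconditional via
Baker's theorem) registered and LANDED (p155595, `LiftingCriteriaDilationLiftAtOneBakerSector.lean`); RESHAPE 2 — S3″
`stub_bakerSectorComplex` (all simple poles, real or complex; Literature `KZ.dilationBakerSectorComplex_lift` p158240)
registered and LANDED (p158467, `LiftingCriteriaDilationLiftAtOneBakerSectorComplex.lean`); RESHAPE 3 — S3‴
`stub_dimOneRational` (every one-variable RATIONAL KZ combination is represented by complex Baker-sector data: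
partial fractions over `ℚ̄`, Literature `KZ.BakerSectorComplex.exists_complexSector_repr_rational` p160771) registered and
LANDED (p161775, `LiftingCriteriaDilationLiftAtOneDimOneRational.lean`, with corollary `dilationLiftAtOne_dimOneRational`);
with it the composition settles the crux for ALL one-variable rational data; RESHAPE 4 — S3⁗ `stub_dimTwoStokesRational`
(Stokes descent for two-variable x₀-exact rational data h = ∂₀(P/Q): v_h = v_k + (ϖ−1)∫Ψ₁, k one-variable rational, Ψ₁ a
rational Nash kernel — exact polynomial division, Literature `KZ.StokesDescent.*`) registered and LANDED (p163647,
`LiftingCriteriaDilationLiftAtOneDimTwoStokes.lean`, corollary `dilationLiftAtOne_dimTwoStokesRational`); with S3‴+S3″+S4 the composition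
settles the crux for all such dim-2 data (first two-dimensional sector = the Stokes sector of "moves lift"); RESHAPE 5 — S3⁵
`stub_liouvilleSector` (one-variable data in LIOUVILLE normal form g = N' + Σ Re(c_k w_k'/w_k) with Nash LOOPS w_k = u_k + iv_k in the
slit plane: every algebraic integrand with elementary antiderivative, ⊇ genus 0 ⊇ ℚ(x); Baker on DIFFERENCES of logs, Möbius-normalised
angle halving; Literature `KZ.dilationLiouvilleSector_lift`) registered; open: S3 only.

Crux (verbatim the route decl `…Theses.LiftingCriteria.DilationLiftAtOne`): for Nash cube functions
`g_i` (dimensions `n_i`), integers `m_i`, `m₀` with `m₀ + Σ m_i ∫_{[0,1]^{n_i}} g_i = 0`, the dilation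
G-function `w(ϖ) = m₀ + Σ m_i v_{g_i}(ϖ)`, `v_g(ϖ) := ∫_{[0,1]^n} g(ϖ z) dz`, factors on `[0,1]` as
`(ϖ − 1)·(μ₀(ϖ) + Σ_j μ_j(ϖ) v_{G_j}(ϖ))` with further Nash cube functions `G_j` and polynomials `μ`
with real-algebraic coefficients ("`ev₁` is injective on `D/(ϖ−1)D`" for the dilation module `D`).

## The line: purity at `ϖ = 1` is LOCAL and FREE; the crux is a one-point Cousin problem

Write `D'` for the class of *twisted-diagonal Nash integrals* `ϖ ↦ ∫_{[0,1]^d} K(ϖ, ϖy) dy`, `K`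
`ℚ`-semialgebraic and real-analytic on an open set of `ℝ^{1+d}` containing the relevant
`{ϖ} × [0,1]^d` (kernels are functions of `p : Fin (d+1) → ℝ`, `p 0 = ϖ`, evaluated at
`Matrix.vecCons ϖ (ϖ • y)`). Two observations organise the skeleton.
(i) `ℝ_alg[ϖ]·D = D'` on `[0,1]` and every element of `D'` is ONE dilation function: for `K` as
above, `G := ∂₀(x₀ K)` is Nash near `[0,1]^{1+d}` and `∫_{[0,1]^{1+d}} G(ϖ y') dy' = ∫_{[0,1]^d} K(ϖ, ϖ y) dy`
(the device of the refuter's day-one certificate for `g₁ = 1/(1+z²)`, `g₂ = 2z/(1+z⁴)`, evidence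
`DilationLiftAtOne_cheapest_falsifier_certificate.md` on the item: `u = ∫_{[0,1]²} ∂_a[aR](ϖz) dz`).
(ii) The factorisation `w = (ϖ − 1)·u`, `u ∈ D'`, holds LOCALLY near every point of `[0,1]` with
no arithmetic input: away from `1` divide the kernel of `w` by `ϖ − 1`; AT `1`, for a single Nash
cube function `h` with `∫ h = 0`,
`v_h(ϖ) = ∫_1^ϖ v_h′ = (ϖ − 1) ∫_0^1 ∫_{[0,1]^N} (Eh)(σ_t z)/σ_t dz dt`, `σ_t = 1 + t(ϖ − 1)`,
`Eh = Σ x_k ∂_k h` the Euler derivative (Nash), and the integrand IS a twisted-diagonal kernel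
`K₁(ϖ, ϖt, ϖz)` with `K₁(ϖ,a,x) = (Eh)((1 + (ϖ−1)a/ϖ)·x/ϖ)/(1 + (ϖ−1)a/ϖ)`, Nash on a
neighbourhood of `{1} × [0,1]^{1+N}` — but NOT down to `ϖ = 0`. So all the (GPC-strength)
content of the crux is the passage from the local kernel at `1` plus the global polar kernel
`h(x)/(ϖ − 1)` to ONE kernel regular on a neighbourhood of `[0,1] × cube`: a Cousin problem at one
point for the sheaf-like class `D'`, modulo NULL kernels (kernels with vanishing fibre integrals).
That is the transfer this line registers; the Taylor-coefficient invariant of the certificate file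
(all Taylor coefficients at `0` of elements of `ℝ_alg[ϖ]·D` are algebraic; `w(1) = 0` is what
neutralises it for `w/(ϖ−1)`) is automatically respected, since the glue keeps `w` itself global.

* `stub_singleGenerator` (S1, normal form; provable now, M): `m₀ + Σ m_i v_{g_i} = v_h` on `[0,1]`
  for ONE Nash cube function `h` (pad dimensions: `h(z) = m₀ + Σ m_i g_i(z|block i)`, Fubini /
  marginals of the product Lebesgue measure on the unit cube; semialgebraicity by
  `IsSemialgebraic.preimage_aeval` + `IsSemialgebraicFunOn.add/mul`).
* `stub_localPurityAtOne` (S2, real analysis; provable now, M/L): for `h` Nash cube with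
  `∫ h = 0` there are `ε > 0` and a kernel `K₁` Nash near `(1−ε,1] × [0,1]^{d₁}` with
  `v_h(ϖ) = (ϖ − 1) ∫ K₁(ϖ, ϖy) dy` for `ϖ ∈ (1−ε, 1]` (differentiation under the integral sign,
  `ϖ v_h′ = v_{Eh}`, FTC, the substitution `s = 1 + t(ϖ−1)`; semialgebraicity of `∂_k h` is the
  tree fact `IsSemialgebraicFunOn.hasDerivAt_isSemialgebraic` (SemialgebraicDerivative.lean)).
* `stub_glueAtOne` (S3, THE BET — the crux transferred to a one-point Cousin problem; open,
  GPC-strength like the crux): a dilation function `v_h` (`h` Nash near the closed cube) that is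
  `(ϖ−1)·D'` near `ϖ = 1` is `(ϖ−1)·D'` on all of `[0,1]` with ONE kernel Nash near
  `[0,1] × [0,1]^d`. Why it might fail: exactly as the crux (CM test `K = K′` at `k² = 1/2` in cube
  form); why easier: the obstruction is now localised — remove the polar divisor `ϖ = 1` from the
  global kernel `h(x)/(ϖ−1)` given a regular local representative, i.e. show the residue kernel
  `h` (a NULL kernel: `∫ h = 0`) is cohomologous to zero in `D'` compatibly with the local data;
  tools: structure of null kernels (relative divergences on the cube — where
  `noSemialgebraicPrimitive_inv_sub_two` warns that primitives must be allowed extra cube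
  variables, as in (i)), Nash approximation/extension (Efroymson, Artin–Mazur), monodromy of the
  Picard–Fuchs system of the pencil at `ϖ = 1`.
* `stub_twistedDiagonal` (S4, provable now, M): observation (i) — a kernel Nash near
  `[0,1] × [0,1]^d` gives one Nash cube function `G` on `[0,1]^{d+1}` with
  `∫ K(ϖ, ϖy) dy = ∫ G(ϖ y') dy'` on `[0,1]` (`G = ∂₀(x₀K)`, FTC in the first cube variable, Fubini
  `Fin (d+1) ≃ Fin 1 × Fin d`, derivative fact as in S2).

`DilationLiftAtOne_of_stubs : S1 → S2 → S3 → S4 → ‹DilationLiftAtOne unfolded verbatim›` (explicit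
hypotheses, real proof) and `DilationLiftAtOne_of : DilationLiftAtOne` (the stubs plugged in by name; the
only theorem concluding the crux by its route name): S1 turns the
data into one `h` with `v_h(1) = 0`; S2 gives the local factorisation at `1`; S3 globalises it to
one kernel `K` on `[0,1]`; S4 turns `∫ K(ϖ,ϖy)dy` into `v_G`; the crux's witness is `T = 1`,
`d = d+1`, `G`, `μ = 1`, `μ₀ = 0` (coefficients `0`, `1` are algebraic).

Disproof used: none — `ledger crux ls stmt-KontsevichZagierPeriods-3571` lists no workfiles (no
`Disproof.lean`, no landed `Theorems/DilationLiftAtOne/Negative/*`, 2026-08-17); dead lines: none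
registered; negatives index of the summit: 1 entry (KinematicPlaneConvex, `K = ∅`), unrelated — no
stub quantifies over semialgebraic sets without the cube containment, and the empty-family case
`S = 0` of S1 is the constant `m₀` (dimension `N = 0`, `h ≡ m₀`).
Barriers: `kzConjecture_implies_oddZetaAlgIndep`, `…_twoPiI_log_algIndep`,
`…_ellipticPeriods_algIndep` (GPC-dependence barriers) are engaged by S3 exactly as by the crux —
not evaded, by design of the route (crux 2 is its single GPC-strength bet); S1, S2, S4 are
transcendence-free. `noSemialgebraicPrimitive_inv_sub_two`: respected — no stub asserts a
semialgebraic primitive in the pencil variable; S2/S4 only differentiate Nash data, and the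
kernels of `D'` carry extra cube variables (the certificate's `d = 2` generator for an `n = 1`
relation is the model).
-/

noncomputable section

-- `Summit.KontsevichZagierPeriods.KontsevichZagierPeriods.…` is the tree's mandated layout (single-conjunct summit).
set_option linter.dupNamespace false

namespace Summit.KontsevichZagierPeriods.KontsevichZagierPeriods.Cruxes.DilationLiftAtOne.Birth

open scoped BigOperators
open MeasureTheory Set
open Summit.KontsevichZagierPeriods.KontsevichZagierPeriods.Theses.LiftingCriteria (DilationLiftAtOne)

/-! ### Registered stubs -/

/-- **Stub S1 — single-generator normal form (provable now, M).** An integer combination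
`m₀ + Σ m_i v_{g_i}` of dilation functions of Nash cube functions `g_i` (any dimensions `n_i`) is
the dilation function `v_h` of ONE Nash cube function `h` of some dimension `N`, on `[0,1]`:
`h(z) = m₀ + Σ m_i g_i(z|block i)` on `W = ⋂ (block i)⁻¹ U_i` (marginals of Lebesgue measure on the
unit cube have mass `1`). Transcendence-free bookkeeping of the dilation module; does not mention
the vanishing hypothesis. [cite: KontsevichZagier2001, §1.2] -/
theorem stub_singleGenerator :
    ∀ (S : ℕ) (n : Fin S → ℕ) (g : (i : Fin S) → (Fin (n i) → ℝ) → ℝ) (U : (i : Fin S) → Set (Fin (n i) → ℝ)), (∀ i, IsOpen (U i) ∧ Set.pi Set.univ (fun _ : Fin (n i) => Set.Icc (0:ℝ) 1) ⊆ (U i) ∧ Literature.NumberTheory.Transcendental.IsSemialgebraicFunOn ℚ (U i) (g i) ∧ AnalyticOnNhd ℝ (g i) (U i)) → ∀ (m : Fin S → ℤ) (m₀ : ℤ), ∃ (N : ℕ) (h : (Fin N → ℝ) → ℝ) (W : Set (Fin N → ℝ)), (IsOpen W ∧ Set.pi Set.univ (fun _ : Fin N => Set.Icc (0:ℝ) 1)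 ⊆ W ∧ Literature.NumberTheory.Transcendental.IsSemialgebraicFunOn ℚ W h ∧ AnalyticOnNhd ℝ h W) ∧ ∀ ϖ ∈ Set.Icc (0:ℝ) 1, (m₀ : ℝ) + ∑ i, (m i : ℝ) * (∫ z in Set.pi Set.univ (fun _ : Fin (n i) => Set.Icc (0:ℝ) 1), g i (ϖ • z)) = ∫ z in Set.pi Set.univ (fun _ : Fin N => Set.Icc (0:ℝ) 1), h (ϖ • z) :=
  Summit.KontsevichZagierPeriods.LiftingCriteria.DilationLiftAtOne.stub_singleGenerator

/-- **Stub S2 — local purity at `ϖ = 1` (real analysis, provable now, M/L).** For one Nash cube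
function `h` of dimension `N` with `∫_{[0,1]^N} h = 0`, the dilation function factors NEAR `ϖ = 1`
through a twisted-diagonal Nash kernel: there are `ε > 0`, `d₁`, an open `V₁ ⊇ (1−ε,1] × [0,1]^{d₁}`
and `K₁` `ℚ`-semialgebraic and analytic on `V₁` with
`∫ h(ϖz)dz = (ϖ − 1) ∫_{[0,1]^{d₁}} K₁(ϖ, ϖy) dy` for `ϖ ∈ (1−ε, 1]`. Intended witness: `d₁ = 1 + N`,
`K₁(ϖ,a,x) = (Eh)((1 + (ϖ−1)a/ϖ)·x/ϖ)/(1 + (ϖ−1)a/ϖ)`, `Eh = Σ x_k ∂_k h`, from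
`v_h(ϖ) − v_h(1) = ∫_1^ϖ v_{Eh}(s) ds/s` and `s = 1 + t(ϖ−1)`; semialgebraicity of `∂_k h` by
`Literature.NumberTheory.Transcendental.IsSemialgebraicFunOn.hasDerivAt_isSemialgebraic`.
No kernel of this shape is claimed near `ϖ = 0` (that is S3). [cite: KontsevichZagier2001, §1.2] -/
theorem stub_localPurityAtOne :
    ∀ (N : ℕ) (h : (Fin N → ℝ) → ℝ) (W : Set (Fin N → ℝ)), IsOpen W → Set.pi Set.univ (fun _ : Fin N => Set.Icc (0:ℝ) 1) ⊆ W → Literature.NumberTheory.Transcendental.IsSemialgebraicFunOn ℚ W h → AnalyticOnNhd ℝ h W → (∫ z in Set.pi Set.univ (fun _ : Fin N => Set.Icc (0:ℝ) 1), h ((1:ℝ) • z)) = 0 → ∃ (ε : ℝ) (d₁ : ℕ) (K₁ : (Fin (d₁ + 1) → ℝ) → ℝ) (V₁ : Set (Fin (d₁ + 1) → ℝ)), 0 < ε ∧ IsOpen V₁ ∧ (∀ ϖ ∈ Set.Ioc (1 - ε) 1, ∀ x ∈ Set.pi Set.univ (fun _ : Fin d₁ => Set.Icc (0:ℝ) 1),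 Matrix.vecCons ϖ x ∈ V₁) ∧ Literature.NumberTheory.Transcendental.IsSemialgebraicFunOn ℚ V₁ K₁ ∧ AnalyticOnNhd ℝ K₁ V₁ ∧ ∀ ϖ ∈ Set.Ioc (1 - ε) 1, (∫ z in Set.pi Set.univ (fun _ : Fin N => Set.Icc (0:ℝ) 1), h (ϖ • z)) = (ϖ - 1) * ∫ y in Set.pi Set.univ (fun _ : Fin d₁ => Set.Icc (0:ℝ) 1), K₁ (Matrix.vecCons ϖ (ϖ • y)) :=
  Summit.KontsevichZagierPeriods.LiftingCriteria.DilationLiftAtOne.stub_localPurityAtOne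

/-- **Stub S3 — glue at `ϖ = 1` (THE BET: the crux as a one-point Cousin problem for
twisted-diagonal Nash kernels; open, GPC-strength).** If the dilation function of a Nash cube
function `h` factors as `(ϖ − 1)·∫ K₁(ϖ, ϖy) dy` NEAR `ϖ = 1` with `K₁` Nash near
`(1−ε, 1] × [0,1]^{d₁}`, then it factors on ALL of `[0,1]` through ONE kernel `K` Nash on an open set
containing `[0,1] × [0,1]^d`. (Away from `1` the factorisation is free — kernel `h(x)/(ϖ−1)` — so
the content is removing the polar divisor `ϖ = 1` modulo null kernels, compatibly with the local
representative.) Why it might fail: as the crux — a special-fibre relation (CM test `K = K′`,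
`k² = 1/2`, in cube form) whose quotient is not globally representable; implied by the crux and,
with S1, S2, S4, implies it. [cite: KontsevichZagier2001, §1.2] -/
theorem stub_glueAtOne :
    ∀ (N : ℕ) (h : (Fin N → ℝ) → ℝ) (W : Set (Fin N → ℝ)), IsOpen W → Set.pi Set.univ (fun _ : Fin N => Set.Icc (0:ℝ) 1) ⊆ W → Literature.NumberTheory.Transcendental.IsSemialgebraicFunOn ℚ W h → AnalyticOnNhd ℝ h W → ∀ (ε : ℝ) (d₁ : ℕ) (K₁ : (Fin (d₁ + 1) → ℝ) → ℝ) (V₁ : Set (Fin (d₁ + 1) → ℝ)), 0 < ε → IsOpen V₁ → (∀ ϖ ∈ Set.Ioc (1 - ε) 1, ∀ x ∈ Set.pi Set.univ (fun _ : Fin d₁ => Set.Icc (0:ℝ) 1), Matrix.vecCons ϖ x ∈ V₁) → Literature.NumberTheory.Transcendental.IsSemialgebraicFunOn ℚ V₁ K₁ → AnalyticOnNhd ℝ K₁ V₁ → (∀ ϖ ∈ Set.Ioc (1 - ε) 1, (∫ z in Set.pi Set.univ (fun _ : Fin N => Set.Icc (0:ℝ) 1), h (ϖ • z)) = (ϖ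 - 1) * ∫ y in Set.pi Set.univ (fun _ : Fin d₁ => Set.Icc (0:ℝ) 1), K₁ (Matrix.vecCons ϖ (ϖ • y))) → ∃ (d : ℕ) (K : (Fin (d + 1) → ℝ) → ℝ) (V : Set (Fin (d + 1) → ℝ)), IsOpen V ∧ (∀ ϖ ∈ Set.Icc (0:ℝ) 1, ∀ x ∈ Set.pi Set.univ (fun _ : Fin d => Set.Icc (0:ℝ) 1), Matrix.vecCons ϖ x ∈ V) ∧ Literature.NumberTheory.Transcendental.IsSemialgebraicFunOn ℚ V K ∧ AnalyticOnNhd ℝ K V ∧ ∀ ϖ ∈ Set.Icc (0:ℝ) 1, (∫ z in Set.pi Set.univ (fun _ : Fin N => Set.Icc (0:ℝ) 1), h (ϖ • z)) = (ϖ - 1) * ∫ y in Set.pi Set.univ (fun _ : Fin d => Set.Icc (0:ℝ) 1), K (Matrix.vecCons ϖ (ϖ • y)) := by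
  sorry

/-- **Stub S4 — twisted-diagonal Nash integrals are single dilation functions (provable now, M).**
For a kernel `K` Nash on an open set containing `[0,1] × [0,1]^d` there is ONE Nash cube function
`G` of dimension `d + 1` with `∫_{[0,1]^d} K(ϖ, ϖy) dy = ∫_{[0,1]^{d+1}} G(ϖ y') dy'` on `[0,1]`:
`G = ∂₀(x₀ K) = K + x₀ ∂₀K` (FTC in the first cube variable: `∫_0^1 G(ϖy₀, ϖy) dy₀ = K(ϖ, ϖy)` for
`ϖ ≠ 0`, continuity at `ϖ = 0`; Fubini `[0,1]^{d+1} = [0,1] × [0,1]^d`; `∂₀K` Nash by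
`IsSemialgebraicFunOn.hasDerivAt_isSemialgebraic`). The device of the item's day-one certificate
(`G(a,b) = ∂_a[a R(a,b)]`). [cite: KontsevichZagier2001, §1.2] -/
theorem stub_twistedDiagonal :
    ∀ (d : ℕ) (K : (Fin (d + 1) → ℝ) → ℝ) (V : Set (Fin (d + 1) → ℝ)), IsOpen V → (∀ ϖ ∈ Set.Icc (0:ℝ) 1, ∀ x ∈ Set.pi Set.univ (fun _ : Fin d => Set.Icc (0:ℝ) 1), Matrix.vecCons ϖ x ∈ V) → Literature.NumberTheory.Transcendental.IsSemialgebraicFunOn ℚ V K → AnalyticOnNhd ℝ K V → ∃ (G : (Fin (d + 1) → ℝ) → ℝ) (V' : Set (Fin (d + 1) → ℝ)), (IsOpen V' ∧ Set.pi Set.univ (fun _ : Fin (d + 1) => Set.Icc (0:ℝ) 1) ⊆ V' ∧ Literature.NumberTheory.Transcendental.IsSemialgebraicFunOn ℚ V' G ∧ AnalyticOnNhd ℝ G V') ∧ ∀ ϖ ∈ Set.Icc (0:ℝ) 1, (∫ y in Set.pi Set.univ (fun _ : Fin d => Set.Icc (0:ℝ) 1), K (Matrix.vecCons ϖ (ϖ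 • y))) = ∫ y' in Set.pi Set.univ (fun _ : Fin (d + 1) => Set.Icc (0:ℝ) 1), G (ϖ • y') :=
  Summit.KontsevichZagierPeriods.LiftingCriteria.DilationLiftAtOne.stub_twistedDiagonal

/-- **Stub S3′ — the real Baker sector of the glue (RESHAPE by lead c2, 2026-08-17; provable
NOW, unconditional via Baker's theorem, which is sorry-free in the tree).** For `ρ` Nash on
`(a,b) ⊇ [0,1]`, real algebraic poles `α_k ∉ (a,b)` with real algebraic residues `c_k`, the
one-variable integrand `g = ρ' + Σ_k c_k/(x − α_k)` (general logarithmic abelian integral with REAL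
data on `ℙ¹`) with vanishing cube period `∫₀¹ g = 0` has a dilation function in `(ϖ − 1)·D'` with
ONE twisted Nash kernel on a neighbourhood of `[0,1] × [0,1]`: exactly the conclusion of S3 for this
`h = g`, `N = 1`, with no local datum needed. Proof (Theorems file
`LiftingCriteriaDilationLiftAtOneBakerSector.lean`): Baker's theorem ⇒ `ρ(1) = ρ(0)` and
`c = Σ_j c_j N_j` with rational exact relations `N_j` among the `log(1 − 1/α_k)`; then
`Σ_k c_k/(x − α_k) = Σ_j c_j Q_j'/Q_j` with `Q_j = Π_k (1 − x/α_k)^{N_{jk}}`, `Q_j(1) = Q_j(0)`, and the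
logarithmic-sector lift `KZ.dilationLogSector_lift` (division trick) applies termwise. This is the
`𝔾ₐ × 𝔾ₘ^A` case of the dimension-one mechanism (analytic subgroup theorem ⇒ null-homotopic Nash
loop ⇒ kernel). [cite: Baker1975, Theorem 2.1] [cite: KontsevichZagier2001, §1.2] -/
theorem stub_bakerSectorReal :
    ∀ (a b : ℝ), a < 0 → 1 < b → ∀ (ρ : ℝ → ℝ), Literature.NumberTheory.Transcendental.IsSemialgebraicFunOn ℚ {t : Fin 1 → ℝ | t 0 ∈ Set.Ioo a b} (fun t => ρ (t 0)) → (∀ x ∈ Set.Ioo a b, AnalyticAt ℝ ρ x) → ∀ (A : ℕ) (α c : Fin A → ℝ), (∀ k, IsAlgebraic ℚ (α k)) → (∀ k, IsAlgebraic ℚ (c k)) → (∀ k, α k ≤ a ∨ b ≤ α k) → (∫ z in Set.pi Set.univ (fun _ : Fin 1 => Set.Icc (0:ℝ) 1), (deriv ρ (((1:ℝ) • z) 0) + ∑ k, c k / (((1:ℝ) • z) 0 - α k))) = 0 → ∃ (K : (Fin 2 → ℝ) → ℝ) (V : Set (Fin 2 → ℝ)), IsOpen V ∧ (∀ ϖ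 ∈ Set.Icc (0:ℝ) 1, ∀ x ∈ Set.pi Set.univ (fun _ : Fin 1 => Set.Icc (0:ℝ) 1), Matrix.vecCons ϖ x ∈ V) ∧ Literature.NumberTheory.Transcendental.IsSemialgebraicFunOn ℚ V K ∧ AnalyticOnNhd ℝ K V ∧ ∀ ϖ ∈ Set.Icc (0:ℝ) 1, (∫ z in Set.pi Set.univ (fun _ : Fin 1 => Set.Icc (0:ℝ) 1), (deriv ρ ((ϖ • z) 0) + ∑ k, c k / ((ϖ • z) 0 - α k))) = (ϖ - 1) * ∫ y in Set.pi Set.univ (fun _ : Fin 1 => Set.Icc (0:ℝ) 1), K (Matrix.vecCons ϖ (ϖ • y)) :=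
  Summit.KontsevichZagierPeriods.LiftingCriteria.DilationLiftAtOne.stub_bakerSectorReal

/-- **Stub S3″ — the complex Baker sector of the glue (RESHAPE 2 by lead c2, 2026-08-17; provable
NOW, unconditional via Baker's theorem in complex form).** For `ρ` Nash on `(a,b) ⊇ [0,1]`, real
algebraic inverse-pole data `(p_k, q_k)` avoiding `[a,b]` and residues `(γ_k, δ_k)`, the integrand
`g = ρ' + Σ_k (γ_k(−p_k + (p_k²+q_k²)x) + δ_k q_k)/((1 − p_k x)² + (q_k x)²)` (all one-variable
rational integrands over `ℚ̄ ∩ ℝ` regular on `[a,b]`, after partial fractions) with vanishing cube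
period has a dilation function in `(ϖ − 1)·D'` with ONE twisted Nash kernel near `[0,1] × [0,1]`.
Proof: Literature `KZ.dilationBakerSectorComplex_lift` (Baker complex ⇒ decomposition of the polar
part along rational exact relations; log sector for real parts, arctangent sector + angle halving
for arguments). Contains the route's day-one test `arctan ϖ − arctan ϖ²`.
[cite: Baker1975, Theorem 2.1] -/
theorem stub_bakerSectorComplex :
    ∀ (a b : ℝ), a < 0 → 1 < b → ∀ (ρ : ℝ → ℝ), Literature.NumberTheory.Transcendental.IsSemialgebraicFunOn ℚ {t : Fin 1 → ℝ | t 0 ∈ Set.Ioo a b} (fun t => ρ (t 0)) → (∀ x ∈ Set.Ioo a b, AnalyticAt ℝ ρ x) → ∀ (A : ℕ) (p q γ δ : Fin A → ℝ), (∀ k, IsAlgebraic ℚ (p k)) → (∀ k, IsAlgebraic ℚ (q k)) → (∀ k, IsAlgebraic ℚ (γ k)) → (∀ k, IsAlgebraic ℚ (δ k)) → (∀ k, ∀ x ∈ Set.Ioo a b, 0 < 1 - p k * x ∨ q k * x ≠ 0) → (∫ z in Set.pi Set.univ (fun _ : Fin 1 => Set.Icc (0:ℝ) 1), (deriv ρ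 (((1:ℝ) • z) 0) + ∑ k, (γ k * (-p k + (p k ^ 2 + q k ^ 2) * (((1:ℝ) • z) 0)) + δ k * q k) / ((1 - p k * (((1:ℝ) • z) 0)) ^ 2 + (q k * (((1:ℝ) • z) 0)) ^ 2))) = 0 → ∃ (K : (Fin 2 → ℝ) → ℝ) (V : Set (Fin 2 → ℝ)), IsOpen V ∧ (∀ ϖ ∈ Set.Icc (0:ℝ) 1, ∀ x ∈ Set.pi Set.univ (fun _ : Fin 1 => Set.Icc (0:ℝ) 1), Matrix.vecCons ϖ x ∈ V) ∧ Literature.NumberTheory.Transcendental.IsSemialgebraicFunOn ℚ V K ∧ AnalyticOnNhd ℝ K V ∧ ∀ ϖ ∈ Set.Icc (0:ℝ) 1, (∫ z in Set.pi Set.univ (fun _ : Fin 1 => Set.Icc (0:ℝ) 1), (deriv ρ ((ϖ • z) 0) + ∑ k, (γ k * (-p k + (p k ^ 2 + q k ^ 2) * ((ϖ • z) 0)) + δ k * q k) / ((1 - p k * ((ϖ • z) 0)) ^ 2 + (q k * ((ϖ • z) 0)) ^ 2))) = (ϖ - 1) * ∫ y in Set.pi Set.univ (fun _ : Fin 1 =>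 Set.Icc (0:ℝ) 1), K (Matrix.vecCons ϖ (ϖ • y)) :=
  Summit.KontsevichZagierPeriods.LiftingCriteria.DilationLiftAtOne.stub_bakerSectorComplex

/-! ### The composition (real proof) -/

/-- **(S3‴) Rational one-variable data are complex Baker-sector data (RESHAPE 3, lead c2).** For
rational functions `P_i/Q_i ∈ ℚ(x)` with `Q_i` non-vanishing on `(a,b) ⊇ [0,1]` (rational `a < 0`,
`1 < b`) and integers `m₀, m_i`, the dilation function `m₀ + Σ m_i v_{P_i/Q_i}` is on `[0,1]` the
dilation function of ONE integrand in Baker normal form `ρ' + Σ residue terms` with algebraic data and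
the slit condition (common denominator + partial fractions over `ℚ̄ ⊂ ℂ` + real parts). Thin wrapper of
Literature `KZ.BakerSectorComplex.exists_complexSector_repr_rational` (p160771); with (S3″)+(S4) it
settles the crux for every one-variable rational KZ combination (`DilationLiftAtOne_of_stubs\'\'\'`).
[cite: Baker1975, Thm. 2.1] -/
theorem stub_dimOneRational :
    ∀ (S : ℕ) (P Q : Fin S → Polynomial ℚ) (a b : ℚ), (a:ℝ) < 0 → 1 < (b:ℝ) → (∀ i, ∀ x ∈ Set.Ioo (a:ℝ) b, Polynomial.aeval x (Q i) ≠ 0) → ∀ (m : Fin S → ℤ) (m₀ : ℤ), ∃ (ρ : ℝ → ℝ) (A : ℕ) (p q γ δ : Fin A → ℝ), Literature.NumberTheory.Transcendental.IsSemialgebraicFunOn ℚ {t : Fin 1 → ℝ | t 0 ∈ Set.Ioo (a:ℝ) b} (fun t => ρ (t 0)) ∧ (∀ x ∈ Set.Ioo (a:ℝ) b, AnalyticAt ℝ ρ x) ∧ (∀ k, IsAlgebraic ℚ (p k)) ∧ (∀ k, IsAlgebraic ℚ (q k)) ∧ (∀ k, IsAlgebraic ℚ (γ k)) ∧ (∀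 k, IsAlgebraic ℚ (δ k)) ∧ (∀ k, ∀ x ∈ Set.Ioo (a:ℝ) b, 0 < 1 - p k * x ∨ q k * x ≠ 0) ∧ ∀ ϖ ∈ Set.Icc (0:ℝ) 1, (m₀ : ℝ) + ∑ i, (m i : ℝ) * (∫ z in Set.pi Set.univ (fun _ : Fin 1 => Set.Icc (0:ℝ) 1), Polynomial.aeval ((ϖ • z) 0) (P i) / Polynomial.aeval ((ϖ • z) 0) (Q i)) = ∫ z in Set.pi Set.univ (fun _ : Fin 1 => Set.Icc (0:ℝ) 1), (deriv ρ ((ϖ • z) 0) + ∑ k, (γ k * (-p k + (p k ^ 2 + q k ^ 2) * ((ϖ • z) 0)) + δ k * q k) / ((1 - p k * ((ϖ • z) 0)) ^ 2 + (q k * ((ϖ • z) 0)) ^ 2)) :=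
  Summit.KontsevichZagierPeriods.LiftingCriteria.DilationLiftAtOne.stub_dimOneRational

/-- **(S3⁗) Stokes descent for two-variable `x₀`-exact rational data (RESHAPE 4, lead c2).** For
`B_i = P_i/Q_i ∈ ℚ(x₀,x₁)` regular on `(a,b)² ⊇ [0,1]²` and `h_i = ∂₀B_i`: one-variable rational data
`Kn_i/Kd_i` regular on `(a,b)` (`k_i(u) = B_i(1,u) − B_i(0,u)`) and kernels `K_i` Nash on an open
`V ⊇ [0,1] × [0,1]` with `v_{h_i}(ϖ) = v_{k_i}(ϖ) + (ϖ − 1)∫₀¹ K_i(ϖ, ϖy) dy` on `[0,1]` — the Stokes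
move LIFTS through the dilation pencil with an explicit rational kernel (exact polynomial division
`N = t(t−1)N₁`, no analytic division). Thin wrapper of Literature
`KZ.StokesDescent.exists_stokes_repr_dimTwo`. [cite: KontsevichZagier2001, §1.2] -/
theorem stub_dimTwoStokesRational :
    ∀ (S : ℕ) (P Q : Fin S → MvPolynomial (Fin 2) ℚ) (a b : ℚ), (a:ℝ) < 0 → 1 < (b:ℝ) → (∀ i, ∀ p ∈ Set.pi Set.univ (fun _ : Fin 2 => Set.Ioo (a:ℝ) b), MvPolynomial.aeval p (Q i) ≠ 0) → ∃ (Kn Kd : Fin S → Polynomial ℚ) (K : Fin S → (Fin 2 → ℝ) → ℝ) (V : Set (Fin 2 → ℝ)), (∀ i, ∀ x ∈ Set.Ioo (a:ℝ) b, Polynomial.aeval x (Kd i) ≠ 0) ∧ IsOpen V ∧ (∀ ϖ ∈ Set.Icc (0:ℝ) 1, ∀ x ∈ Set.pi Set.univ (fun _ : Fin 1 => Set.Icc (0:ℝ) 1), Matrix.vecCons ϖ x ∈ V) ∧ (∀ i, Literature.NumberTheory.Transcendental.IsSemialgebraicFunOn ℚ V (K i)) ∧ (∀ i, AnalyticOnNhd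 ℝ (K i) V) ∧ ∀ i, ∀ ϖ ∈ Set.Icc (0:ℝ) 1, (∫ z in Set.pi Set.univ (fun _ : Fin 2 => Set.Icc (0:ℝ) 1), (MvPolynomial.aeval (ϖ • z) (MvPolynomial.pderiv 0 (P i)) * MvPolynomial.aeval (ϖ • z) (Q i) - MvPolynomial.aeval (ϖ • z) (P i) * MvPolynomial.aeval (ϖ • z) (MvPolynomial.pderiv 0 (Q i))) / (MvPolynomial.aeval (ϖ • z) (Q i)) ^ 2) = (∫ z in Set.pi Set.univ (fun _ : Fin 1 => Set.Icc (0:ℝ) 1), Polynomial.aeval ((ϖ • z) 0) (Kn i) / Polynomial.aeval ((ϖ • z) 0) (Kd i)) + (ϖ - 1) * ∫ y in Set.pi Set.univ (fun _ : Fin 1 => Set.Icc (0:ℝ) 1), K i (Matrix.vecCons ϖ (ϖ • y)) :=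
  Summit.KontsevichZagierPeriods.LiftingCriteria.DilationLiftAtOne.stub_dimTwoStokesRational

/-- **(S3⁵) The Liouville sector (RESHAPE 5, lead c2).** For `N` Nash on `(a,b) ⊇ [0,1]`, Nash
loops `w_k = u_k + iv_k` in the slit plane, algebraic `c_k = γ_k + iδ_k`: the integrand in Liouville
normal form `g = N' + Σ_k Re(c_k w_k'/w_k)` (every one-variable algebraic datum with ELEMENTARY
antiderivative `N + Σ c_k log w_k`; ⊇ genus-0 data ⊇ `ℚ(x)`) with `∫₀¹ g = 0` has `v_g ∈ (ϖ − 1)·D'`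
with one Nash kernel on `[0,1]`. Thin wrapper of Literature `KZ.dilationLiouvilleSector_lift` (Baker's
theorem on DIFFERENCES of logarithms — any determination —, normalised moduli, Möbius-normalised angle
halving). [cite: Baker1975, Thm. 2.1] -/
theorem stub_liouvilleSector :
    ∀ (a b : ℝ), a < 0 → 1 < b → ∀ (N : ℝ → ℝ), Literature.NumberTheory.Transcendental.IsSemialgebraicFunOn ℚ {t : Fin 1 → ℝ | t 0 ∈ Set.Ioo a b} (fun t => N (t 0)) → (∀ x ∈ Set.Ioo a b, AnalyticAt ℝ N x) → ∀ (A : ℕ) (u v : Fin A → ℝ → ℝ), (∀ k, Literature.NumberTheory.Transcendental.IsSemialgebraicFunOn ℚ {t : Fin 1 → ℝ | t 0 ∈ Set.Ioo a b} (fun t => u k (t 0))) → (∀ k, Literature.NumberTheory.Transcendental.IsSemialgebraicFunOn ℚ {t : Fin 1 → ℝ | t 0 ∈ Set.Ioo a b} (fun t => v k (t 0))) → (∀ k, ∀ x ∈ Set.Ioo a b, AnalyticAt ℝ (u k) x) → (∀ k, ∀ x ∈ Set.Ioo a b, AnalyticAt ℝ (v k) x) → (∀ k, ∀ x ∈ Set.Ioo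 a b, 0 < u k x ∨ v k x ≠ 0) → ∀ (γ δ : Fin A → ℝ), (∀ k, IsAlgebraic ℚ (γ k)) → (∀ k, IsAlgebraic ℚ (δ k)) → (∫ z in Set.pi Set.univ (fun _ : Fin 1 => Set.Icc (0:ℝ) 1), (deriv N (((1:ℝ) • z) 0) + ∑ k, (γ k * ((deriv (u k) (((1:ℝ) • z) 0) * u k (((1:ℝ) • z) 0) + deriv (v k) (((1:ℝ) • z) 0) * v k (((1:ℝ) • z) 0)) / (u k (((1:ℝ) • z) 0) ^ 2 + v k (((1:ℝ) • z) 0) ^ 2)) - δ k * ((deriv (v k) (((1:ℝ) • z) 0) * u k (((1:ℝ) • z) 0) - deriv (u k) (((1:ℝ) • z) 0) * v k (((1:ℝ) • z) 0)) / (u k (((1:ℝ) • z) 0) ^ 2 + v k (((1:ℝ) • z) 0) ^ 2))))) = 0 → ∃ (K : (Fin 2 → ℝ) → ℝ) (V : Set (Fin 2 → ℝ)), IsOpen V ∧ (∀ ϖ ∈ Set.Icc (0:ℝ) 1, ∀ x ∈ Set.pi Set.univ (fun _ : Fin 1 => Set.Icc (0:ℝ) 1), Matrix.vecCons ϖ x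 ∈ V) ∧ Literature.NumberTheory.Transcendental.IsSemialgebraicFunOn ℚ V K ∧ AnalyticOnNhd ℝ K V ∧ ∀ ϖ ∈ Set.Icc (0:ℝ) 1, (∫ z in Set.pi Set.univ (fun _ : Fin 1 => Set.Icc (0:ℝ) 1), (deriv N ((ϖ • z) 0) + ∑ k, (γ k * ((deriv (u k) ((ϖ • z) 0) * u k ((ϖ • z) 0) + deriv (v k) ((ϖ • z) 0) * v k ((ϖ • z) 0)) / (u k ((ϖ • z) 0) ^ 2 + v k ((ϖ • z) 0) ^ 2)) - δ k * ((deriv (v k) ((ϖ • z) 0) * u k ((ϖ • z) 0) - deriv (u k) ((ϖ • z) 0) * v k ((ϖ • z) 0)) / (u k ((ϖ • z) 0) ^ 2 + v k ((ϖ • z) 0) ^ 2))))) = (ϖ - 1) * ∫ y in Set.pi Set.univ (fun _ : Fin 1 => Set.Icc (0:ℝ) 1), K (Matrix.vecCons ϖ (ϖ • y)) := by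
  sorry

/-- **Decomposition theorem (explicit hypotheses = the four stub statements, no `sorry`).**
Normal form (S1), local purity at `1` (S2), glue (S3) and the twisted-diagonal device (S4) give the
crux with witness `T = 1`, `d = d + 1`, `G`, `μ = 1`, `μ₀ = 0`. The conclusion is the crux UNFOLDED
verbatim (the body of the route decl), so that exactly one theorem of this file, `DilationLiftAtOne_of`,
concludes the crux by its route name (skeleton audit). [cite: KontsevichZagier2001, §1.2] -/
theorem DilationLiftAtOne_of_stubs
    (h₁ : ∀ (S : ℕ) (n : Fin S → ℕ) (g : (i : Fin S) → (Fin (n i) → ℝ) → ℝ) (U : (i : Fin S) → Set (Fin (n i) → ℝ)), (∀ i, IsOpen (U i) ∧ Set.pi Set.univ (fun _ : Fin (n i) => Set.Icc (0:ℝ) 1) ⊆ (U i) ∧ Literature.NumberTheory.Transcendental.IsSemialgebraicFunOn ℚ (U i) (g i) ∧ AnalyticOnNhd ℝ (g i) (U i)) → ∀ (m : Fin S → ℤ) (m₀ : ℤ), ∃ (N : ℕ) (h : (Fin N → ℝ) → ℝ) (W : Set (Fin N → ℝ)), (IsOpen W ∧ Set.pi Set.univ (fun _ : Fin N => Set.Icc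 (0:ℝ) 1) ⊆ W ∧ Literature.NumberTheory.Transcendental.IsSemialgebraicFunOn ℚ W h ∧ AnalyticOnNhd ℝ h W) ∧ ∀ ϖ ∈ Set.Icc (0:ℝ) 1, (m₀ : ℝ) + ∑ i, (m i : ℝ) * (∫ z in Set.pi Set.univ (fun _ : Fin (n i) => Set.Icc (0:ℝ) 1), g i (ϖ • z)) = ∫ z in Set.pi Set.univ (fun _ : Fin N => Set.Icc (0:ℝ) 1), h (ϖ • z))
    (h₂ : ∀ (N : ℕ) (h : (Fin N → ℝ) → ℝ) (W : Set (Fin N → ℝ)), IsOpen W → Set.pi Set.univ (fun _ : Fin N => Set.Icc (0:ℝ) 1) ⊆ W → Literature.NumberTheory.Transcendental.IsSemialgebraicFunOn ℚ W h → AnalyticOnNhd ℝ h W → (∫ z in Set.pi Set.univ (fun _ : Fin N => Set.Icc (0:ℝ) 1), h ((1:ℝ) • z)) = 0 → ∃ (ε : ℝ) (d₁ : ℕ) (K₁ : (Fin (d₁ + 1) → ℝ) → ℝ) (V₁ : Set (Fin (d₁ + 1) → ℝ)), 0 < ε ∧ IsOpen V₁ ∧ (∀ ϖ ∈ Set.Ioc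 (1 - ε) 1, ∀ x ∈ Set.pi Set.univ (fun _ : Fin d₁ => Set.Icc (0:ℝ) 1), Matrix.vecCons ϖ x ∈ V₁) ∧ Literature.NumberTheory.Transcendental.IsSemialgebraicFunOn ℚ V₁ K₁ ∧ AnalyticOnNhd ℝ K₁ V₁ ∧ ∀ ϖ ∈ Set.Ioc (1 - ε) 1, (∫ z in Set.pi Set.univ (fun _ : Fin N => Set.Icc (0:ℝ) 1), h (ϖ • z)) = (ϖ - 1) * ∫ y in Set.pi Set.univ (fun _ : Fin d₁ => Set.Icc (0:ℝ) 1), K₁ (Matrix.vecCons ϖ (ϖ • y)))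
    (h₃ : ∀ (N : ℕ) (h : (Fin N → ℝ) → ℝ) (W : Set (Fin N → ℝ)), IsOpen W → Set.pi Set.univ (fun _ : Fin N => Set.Icc (0:ℝ) 1) ⊆ W → Literature.NumberTheory.Transcendental.IsSemialgebraicFunOn ℚ W h → AnalyticOnNhd ℝ h W → ∀ (ε : ℝ) (d₁ : ℕ) (K₁ : (Fin (d₁ + 1) → ℝ) → ℝ) (V₁ : Set (Fin (d₁ + 1) → ℝ)), 0 < ε → IsOpen V₁ → (∀ ϖ ∈ Set.Ioc (1 - ε) 1, ∀ x ∈ Set.pi Set.univ (fun _ : Fin d₁ => Set.Icc (0:ℝ) 1), Matrix.vecCons ϖ x ∈ V₁) → Literature.NumberTheory.Transcendental.IsSemialgebraicFunOn ℚ V₁ K₁ → AnalyticOnNhd ℝ K₁ V₁ → (∀ ϖ ∈ Set.Ioc (1 - ε) 1, (∫ z in Set.pi Set.univ (fun _ : Fin N => Set.Icc (0:ℝ) 1), h (ϖ • z)) = (ϖ - 1) * ∫ y in Set.pi Set.univ (fun _ : Fin d₁ => Set.Icc (0:ℝ) 1), K₁ (Matrix.vecCons ϖ (ϖ • y))) →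 ∃ (d : ℕ) (K : (Fin (d + 1) → ℝ) → ℝ) (V : Set (Fin (d + 1) → ℝ)), IsOpen V ∧ (∀ ϖ ∈ Set.Icc (0:ℝ) 1, ∀ x ∈ Set.pi Set.univ (fun _ : Fin d => Set.Icc (0:ℝ) 1), Matrix.vecCons ϖ x ∈ V) ∧ Literature.NumberTheory.Transcendental.IsSemialgebraicFunOn ℚ V K ∧ AnalyticOnNhd ℝ K V ∧ ∀ ϖ ∈ Set.Icc (0:ℝ) 1, (∫ z in Set.pi Set.univ (fun _ : Fin N => Set.Icc (0:ℝ) 1), h (ϖ • z)) = (ϖ - 1) * ∫ y in Set.pi Set.univ (fun _ : Fin d => Set.Icc (0:ℝ) 1), K (Matrix.vecCons ϖ (ϖ • y)))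
    (h₄ : ∀ (d : ℕ) (K : (Fin (d + 1) → ℝ) → ℝ) (V : Set (Fin (d + 1) → ℝ)), IsOpen V → (∀ ϖ ∈ Set.Icc (0:ℝ) 1, ∀ x ∈ Set.pi Set.univ (fun _ : Fin d => Set.Icc (0:ℝ) 1), Matrix.vecCons ϖ x ∈ V) → Literature.NumberTheory.Transcendental.IsSemialgebraicFunOn ℚ V K → AnalyticOnNhd ℝ K V → ∃ (G : (Fin (d + 1) → ℝ) → ℝ) (V' : Set (Fin (d + 1) → ℝ)), (IsOpen V' ∧ Set.pi Set.univ (fun _ : Fin (d + 1) => Set.Icc (0:ℝ) 1) ⊆ V' ∧ Literature.NumberTheory.Transcendental.IsSemialgebraicFunOn ℚ V' G ∧ AnalyticOnNhd ℝ G V') ∧ ∀ ϖ ∈ Set.Icc (0:ℝ) 1, (∫ y in Set.pi Set.univ (fun _ : Fin d => Set.Icc (0:ℝ) 1), K (Matrix.vecCons ϖ (ϖ • y))) = ∫ y' in Set.pi Set.univ (fun _ : Fin (d + 1) => Set.Icc (0:ℝ) 1), G (ϖ • y')) :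
    ∀ (S : ℕ) (n : Fin S → ℕ) (g : (i : Fin S) → (Fin (n i) → ℝ) → ℝ) (U : (i : Fin S) → Set (Fin (n i) → ℝ)), (∀ i, IsOpen (U i) ∧ Set.pi Set.univ (fun _ : Fin (n i) => Set.Icc (0:ℝ) 1) ⊆ (U i) ∧ Literature.NumberTheory.Transcendental.IsSemialgebraicFunOn ℚ (U i) (g i) ∧ AnalyticOnNhd ℝ (g i) (U i)) → ∀ (m : Fin S → ℤ) (m₀ : ℤ), (m₀ : ℝ) + ∑ i, (m i : ℝ) * (∫ z in Set.pi Set.univ (fun _ : Fin (n i) => Set.Icc (0:ℝ) 1), g i ((1:ℝ) • z)) = 0 → ∃ (T : ℕ) (d : Fin T → ℕ) (G : (j : Fin T) → (Fin (d j) → ℝ) → ℝ) (V : (j : Fin T) → Set (Fin (d j) → ℝ)) (μ : Fin T → Polynomial ℝ) (μ₀ : Polynomial ℝ), (∀ j, IsOpen (V j) ∧ Set.pi Set.univ (fun _ : Fin (d j) => Set.Icc (0:ℝ) 1) ⊆ (V j) ∧ Literature.NumberTheory.Transcendental.IsSemialgebraicFunOn ℚ (V j) (G j) ∧ AnalyticOnNhd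 ℝ (G j) (V j)) ∧ (∀ j k, IsAlgebraic ℚ ((μ j).coeff k)) ∧ (∀ k, IsAlgebraic ℚ (μ₀.coeff k)) ∧ ∀ ϖ ∈ Set.Icc (0:ℝ) 1, (m₀ : ℝ) + ∑ i, (m i : ℝ) * (∫ z in Set.pi Set.univ (fun _ : Fin (n i) => Set.Icc (0:ℝ) 1), g i (ϖ • z)) = (ϖ - 1) * (μ₀.eval ϖ + ∑ j, (μ j).eval ϖ * (∫ z in Set.pi Set.univ (fun _ : Fin (d j) => Set.Icc (0:ℝ) 1), G j (ϖ • z))) := by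
  intro S n g U hg m m₀ hsum
  -- (S1) one Nash cube function `h` with `m₀ + Σ mᵢ v_{gᵢ} = v_h` on `[0,1]`
  obtain ⟨N, h, W, ⟨hWo, hWc, hWs, hWa⟩, hv⟩ := h₁ S n g U hg m m₀
  -- the numerical relation at `ϖ = 1` is `v_h(1) = 0`
  have h1 : (∫ z in Set.pi Set.univ (fun _ : Fin N => Set.Icc (0:ℝ) 1), h ((1:ℝ) • z)) = 0 := by
    rw [← hv 1 ⟨zero_le_one, le_rfl⟩]
    exact hsum
  -- (S2) local factorisation through a twisted-diagonal kernel near `ϖ = 1`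
  obtain ⟨ε, d₁, K₁, V₁, hε, hV₁o, hV₁c, hK₁s, hK₁a, hloc⟩ := h₂ N h W hWo hWc hWs hWa h1
  -- (S3) glue: one kernel on all of `[0,1]`
  obtain ⟨d, K, V, hVo, hVc, hKs, hKa, hglob⟩ :=
    h₃ N h W hWo hWc hWs hWa ε d₁ K₁ V₁ hε hV₁o hV₁c hK₁s hK₁a hloc
  -- (S4) the twisted-diagonal integral is one dilation function `v_G`
  obtain ⟨G, V', hG, hGK⟩ := h₄ d K V hVo hVc hKs hKa
  refine ⟨1, fun _ => d + 1, fun _ => G, fun _ => V', fun _ => 1, 0, fun _ => hG, ?_, ?_, ?_⟩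
  · intro j k
    rw [Polynomial.coeff_one]
    split_ifs
    · exact isAlgebraic_one
    · exact isAlgebraic_zero
  · intro k
    rw [Polynomial.coeff_zero]
    exact isAlgebraic_zero
  · intro ϖ hϖ
    rw [hv ϖ hϖ, hglob ϖ hϖ, hGK ϖ hϖ]
    simp

/-- **Decomposition theorem with the Baker-sector stub (RESHAPE, lead c2).** If the integer
combination of the family is REPRESENTED by real Baker-sector data in dimension one
(`m₀ + Σ mᵢ v_{gᵢ} = v_g` on `[0,1]` with `g = ρ' + Σ_k c_k/(x − α_k)` as in S3′), the crux follows
from S3′ and S4 alone (unconditionally once S3′, S4 are landed); otherwise from S1–S4 as before.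
[cite: KontsevichZagier2001, §1.2] -/
theorem DilationLiftAtOne_of_stubs'
    (h₁ : ∀ (S : ℕ) (n : Fin S → ℕ) (g : (i : Fin S) → (Fin (n i) → ℝ) → ℝ) (U : (i : Fin S) → Set (Fin (n i) → ℝ)), (∀ i, IsOpen (U i) ∧ Set.pi Set.univ (fun _ : Fin (n i) => Set.Icc (0:ℝ) 1) ⊆ (U i) ∧ Literature.NumberTheory.Transcendental.IsSemialgebraicFunOn ℚ (U i) (g i) ∧ AnalyticOnNhd ℝ (g i) (U i)) → ∀ (m : Fin S → ℤ) (m₀ : ℤ), ∃ (N : ℕ) (h : (Fin N → ℝ) → ℝ) (W : Set (Fin N → ℝ)), (IsOpen W ∧ Set.pi Set.univ (fun _ : Fin N => Set.Icc (0:ℝ) 1) ⊆ W ∧ Literature.NumberTheory.Transcendental.IsSemialgebraicFunOn ℚ W h ∧ AnalyticOnNhd ℝ h W) ∧ ∀ ϖ ∈ Set.Icc (0:ℝ) 1, (m₀ : ℝ) + ∑ i, (m i : ℝ) * (∫ z in Set.pi Set.univ (fun _ : Fin (n i) => Set.Icc (0:ℝ) 1), g i (ϖ • z)) = ∫ z in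 Set.pi Set.univ (fun _ : Fin N => Set.Icc (0:ℝ) 1), h (ϖ • z))
    (h₂ : ∀ (N : ℕ) (h : (Fin N → ℝ) → ℝ) (W : Set (Fin N → ℝ)), IsOpen W → Set.pi Set.univ (fun _ : Fin N => Set.Icc (0:ℝ) 1) ⊆ W → Literature.NumberTheory.Transcendental.IsSemialgebraicFunOn ℚ W h → AnalyticOnNhd ℝ h W → (∫ z in Set.pi Set.univ (fun _ : Fin N => Set.Icc (0:ℝ) 1), h ((1:ℝ) • z)) = 0 → ∃ (ε : ℝ) (d₁ : ℕ) (K₁ : (Fin (d₁ + 1) → ℝ) → ℝ) (V₁ : Set (Fin (d₁ + 1) → ℝ)), 0 < ε ∧ IsOpen V₁ ∧ (∀ ϖ ∈ Set.Ioc (1 - ε) 1, ∀ x ∈ Set.pi Set.univ (fun _ : Fin d₁ => Set.Icc (0:ℝ) 1), Matrix.vecCons ϖ x ∈ V₁) ∧ Literature.NumberTheory.Transcendental.IsSemialgebraicFunOn ℚ V₁ K₁ ∧ AnalyticOnNhd ℝ K₁ V₁ ∧ ∀ ϖ ∈ Set.Ioc (1 - ε) 1, (∫ z in Set.pi Set.univ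 (fun _ : Fin N => Set.Icc (0:ℝ) 1), h (ϖ • z)) = (ϖ - 1) * ∫ y in Set.pi Set.univ (fun _ : Fin d₁ => Set.Icc (0:ℝ) 1), K₁ (Matrix.vecCons ϖ (ϖ • y)))
    (h₃ : ∀ (N : ℕ) (h : (Fin N → ℝ) → ℝ) (W : Set (Fin N → ℝ)), IsOpen W → Set.pi Set.univ (fun _ : Fin N => Set.Icc (0:ℝ) 1) ⊆ W → Literature.NumberTheory.Transcendental.IsSemialgebraicFunOn ℚ W h → AnalyticOnNhd ℝ h W → ∀ (ε : ℝ) (d₁ : ℕ) (K₁ : (Fin (d₁ + 1) → ℝ) → ℝ) (V₁ : Set (Fin (d₁ + 1) → ℝ)), 0 < ε → IsOpen V₁ → (∀ ϖ ∈ Set.Ioc (1 - ε) 1, ∀ x ∈ Set.pi Set.univ (fun _ : Fin d₁ => Set.Icc (0:ℝ) 1), Matrix.vecCons ϖ x ∈ V₁) → Literature.NumberTheory.Transcendental.IsSemialgebraicFunOn ℚ V₁ K₁ → AnalyticOnNhd ℝ K₁ V₁ → (∀ ϖ ∈ Set.Ioc (1 - ε) 1, (∫ z in Set.pi Set.univ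 (fun _ : Fin N => Set.Icc (0:ℝ) 1), h (ϖ • z)) = (ϖ - 1) * ∫ y in Set.pi Set.univ (fun _ : Fin d₁ => Set.Icc (0:ℝ) 1), K₁ (Matrix.vecCons ϖ (ϖ • y))) → ∃ (d : ℕ) (K : (Fin (d + 1) → ℝ) → ℝ) (V : Set (Fin (d + 1) → ℝ)), IsOpen V ∧ (∀ ϖ ∈ Set.Icc (0:ℝ) 1, ∀ x ∈ Set.pi Set.univ (fun _ : Fin d => Set.Icc (0:ℝ) 1), Matrix.vecCons ϖ x ∈ V) ∧ Literature.NumberTheory.Transcendental.IsSemialgebraicFunOn ℚ V K ∧ AnalyticOnNhd ℝ K V ∧ ∀ ϖ ∈ Set.Icc (0:ℝ) 1, (∫ z in Set.pi Set.univ (fun _ : Fin N => Set.Icc (0:ℝ) 1), h (ϖ • z)) = (ϖ - 1) * ∫ y in Set.pi Set.univ (fun _ : Fin d => Set.Icc (0:ℝ) 1), K (Matrix.vecCons ϖ (ϖ • y)))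
    (h₄ : ∀ (d : ℕ) (K : (Fin (d + 1) → ℝ) → ℝ) (V : Set (Fin (d + 1) → ℝ)), IsOpen V → (∀ ϖ ∈ Set.Icc (0:ℝ) 1, ∀ x ∈ Set.pi Set.univ (fun _ : Fin d => Set.Icc (0:ℝ) 1), Matrix.vecCons ϖ x ∈ V) → Literature.NumberTheory.Transcendental.IsSemialgebraicFunOn ℚ V K → AnalyticOnNhd ℝ K V → ∃ (G : (Fin (d + 1) → ℝ) → ℝ) (V' : Set (Fin (d + 1) → ℝ)), (IsOpen V' ∧ Set.pi Set.univ (fun _ : Fin (d + 1) => Set.Icc (0:ℝ) 1) ⊆ V' ∧ Literature.NumberTheory.Transcendental.IsSemialgebraicFunOn ℚ V' G ∧ AnalyticOnNhd ℝ G V') ∧ ∀ ϖ ∈ Set.Icc (0:ℝ) 1, (∫ y in Set.pi Set.univ (fun _ : Fin d => Set.Icc (0:ℝ) 1), K (Matrix.vecCons ϖ (ϖ • y))) = ∫ y' in Set.pi Set.univ (fun _ : Fin (d + 1) => Set.Icc (0:ℝ) 1), G (ϖ • y'))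
    (h₅ : ∀ (a b : ℝ), a < 0 → 1 < b → ∀ (ρ : ℝ → ℝ), Literature.NumberTheory.Transcendental.IsSemialgebraicFunOn ℚ {t : Fin 1 → ℝ | t 0 ∈ Set.Ioo a b} (fun t => ρ (t 0)) → (∀ x ∈ Set.Ioo a b, AnalyticAt ℝ ρ x) → ∀ (A : ℕ) (α c : Fin A → ℝ), (∀ k, IsAlgebraic ℚ (α k)) → (∀ k, IsAlgebraic ℚ (c k)) → (∀ k, α k ≤ a ∨ b ≤ α k) → (∫ z in Set.pi Set.univ (fun _ : Fin 1 => Set.Icc (0:ℝ) 1), (deriv ρ (((1:ℝ) • z) 0) + ∑ k, c k / (((1:ℝ) • z) 0 - α k))) = 0 → ∃ (K : (Fin 2 → ℝ) → ℝ) (V : Set (Fin 2 → ℝ)), IsOpen V ∧ (∀ ϖ ∈ Set.Icc (0:ℝ) 1, ∀ x ∈ Set.pi Set.univ (fun _ : Fin 1 => Set.Icc (0:ℝ) 1), Matrix.vecCons ϖ x ∈ V) ∧ Literature.NumberTheory.Transcendental.IsSemialgebraicFunOn ℚ V K ∧ AnalyticOnNhd ℝ K V ∧ ∀ ϖ ∈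 Set.Icc (0:ℝ) 1, (∫ z in Set.pi Set.univ (fun _ : Fin 1 => Set.Icc (0:ℝ) 1), (deriv ρ ((ϖ • z) 0) + ∑ k, c k / ((ϖ • z) 0 - α k))) = (ϖ - 1) * ∫ y in Set.pi Set.univ (fun _ : Fin 1 => Set.Icc (0:ℝ) 1), K (Matrix.vecCons ϖ (ϖ • y))) :
    ∀ (S : ℕ) (n : Fin S → ℕ) (g : (i : Fin S) → (Fin (n i) → ℝ) → ℝ) (U : (i : Fin S) → Set (Fin (n i) → ℝ)), (∀ i, IsOpen (U i) ∧ Set.pi Set.univ (fun _ : Fin (n i) => Set.Icc (0:ℝ) 1) ⊆ (U i) ∧ Literature.NumberTheory.Transcendental.IsSemialgebraicFunOn ℚ (U i) (g i) ∧ AnalyticOnNhd ℝ (g i) (U i)) → ∀ (m : Fin S → ℤ) (m₀ : ℤ), (m₀ : ℝ) + ∑ i, (m i : ℝ) * (∫ z in Set.pi Set.univ (fun _ : Fin (n i) => Set.Icc (0:ℝ) 1), g i ((1:ℝ) • z)) = 0 → ∃ (T : ℕ) (d : Fin T → ℕ) (G : (j : Fin T) → (Fin (d j) → ℝ) → ℝ)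 (V : (j : Fin T) → Set (Fin (d j) → ℝ)) (μ : Fin T → Polynomial ℝ) (μ₀ : Polynomial ℝ), (∀ j, IsOpen (V j) ∧ Set.pi Set.univ (fun _ : Fin (d j) => Set.Icc (0:ℝ) 1) ⊆ (V j) ∧ Literature.NumberTheory.Transcendental.IsSemialgebraicFunOn ℚ (V j) (G j) ∧ AnalyticOnNhd ℝ (G j) (V j)) ∧ (∀ j k, IsAlgebraic ℚ ((μ j).coeff k)) ∧ (∀ k, IsAlgebraic ℚ (μ₀.coeff k)) ∧ ∀ ϖ ∈ Set.Icc (0:ℝ) 1, (m₀ : ℝ) + ∑ i, (m i : ℝ) * (∫ z in Set.pi Set.univ (fun _ : Fin (n i) => Set.Icc (0:ℝ) 1), g i (ϖ • z)) = (ϖ - 1) * (μ₀.eval ϖ + ∑ j, (μ j).eval ϖ * (∫ z in Set.pi Set.univ (fun _ : Fin (d j) => Set.Icc (0:ℝ) 1), G j (ϖ • z))) := by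
  intro S n g U hg m m₀ hsum
  classical
  -- is the combination represented by real Baker-sector data in dimension one?
  by_cases hP : ∃ (a b : ℝ) (ρ : ℝ → ℝ) (A : ℕ) (α c : Fin A → ℝ), a < 0 ∧ 1 < b ∧
      Literature.NumberTheory.Transcendental.IsSemialgebraicFunOn ℚ {t : Fin 1 → ℝ | t 0 ∈ Set.Ioo a b} (fun t => ρ (t 0)) ∧
      (∀ x ∈ Set.Ioo a b, AnalyticAt ℝ ρ x) ∧ (∀ k, IsAlgebraic ℚ (α k)) ∧ (∀ k, IsAlgebraic ℚ (c k)) ∧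
      (∀ k, α k ≤ a ∨ b ≤ α k) ∧
      ∀ ϖ ∈ Set.Icc (0:ℝ) 1, (m₀ : ℝ) + ∑ i, (m i : ℝ) *
          (∫ z in Set.pi Set.univ (fun _ : Fin (n i) => Set.Icc (0:ℝ) 1), g i (ϖ • z)) =
        ∫ z in Set.pi Set.univ (fun _ : Fin 1 => Set.Icc (0:ℝ) 1),
          (deriv ρ ((ϖ • z) 0) + ∑ k, c k / ((ϖ • z) 0 - α k))
  · obtain ⟨a, b, ρ, A, α, c, ha, hb, hρs, hρa, hαalg, hcalg, hα, hrepr⟩ := hP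
    have h1 : (∫ z in Set.pi Set.univ (fun _ : Fin 1 => Set.Icc (0:ℝ) 1),
        (deriv ρ (((1:ℝ) • z) 0) + ∑ k, c k / (((1:ℝ) • z) 0 - α k))) = 0 := by
      rw [← hrepr 1 ⟨zero_le_one, le_rfl⟩]
      exact hsum
    -- (S3′) the Baker-sector lift, one kernel on `[0,1]`
    obtain ⟨K, V, hVo, hVc, hKs, hKa, hid⟩ := h₅ a b ha hb ρ hρs hρa A α c hαalg hcalg hα h1
    -- (S4) the twisted-diagonal integral is one dilation function `v_G`
    obtain ⟨G, V', hG, hGK⟩ := h₄ 1 K V hVo hVc hKs hKa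
    refine ⟨1, fun _ => 1 + 1, fun _ => G, fun _ => V', fun _ => 1, 0, fun _ => hG, ?_, ?_, ?_⟩
    · intro j k
      rw [Polynomial.coeff_one]
      split_ifs
      · exact isAlgebraic_one
      · exact isAlgebraic_zero
    · intro k
      rw [Polynomial.coeff_zero]
      exact isAlgebraic_zero
    · intro ϖ hϖ
      rw [hrepr ϖ hϖ, hid ϖ hϖ, hGK ϖ hϖ]
      simp
  · exact DilationLiftAtOne_of_stubs h₁ h₂ h₃ h₄ S n g U hg m m₀ hsum

/-- **Decomposition theorem with both Baker-sector stubs (RESHAPE 2, lead c2).** If the integer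
combination of the family is REPRESENTED by complex Baker-sector data in dimension one, the crux
follows from S3″ and S4 alone (unconditionally once landed); otherwise as in
`DilationLiftAtOne_of_stubs'`. [cite: KontsevichZagier2001, §1.2] -/
theorem DilationLiftAtOne_of_stubs''
    (h₁ : ∀ (S : ℕ) (n : Fin S → ℕ) (g : (i : Fin S) → (Fin (n i) → ℝ) → ℝ) (U : (i : Fin S) → Set (Fin (n i) → ℝ)), (∀ i, IsOpen (U i) ∧ Set.pi Set.univ (fun _ : Fin (n i) => Set.Icc (0:ℝ) 1) ⊆ (U i) ∧ Literature.NumberTheory.Transcendental.IsSemialgebraicFunOn ℚ (U i) (g i) ∧ AnalyticOnNhd ℝ (g i) (U i)) → ∀ (m : Fin S → ℤ) (m₀ : ℤ), ∃ (N : ℕ) (h : (Fin N → ℝ) → ℝ) (W : Set (Fin N → ℝ)), (IsOpen W ∧ Set.pi Set.univ (fun _ : Fin N => Set.Icc (0:ℝ) 1) ⊆ W ∧ Literature.NumberTheory.Transcendental.IsSemialgebraicFunOn ℚ W h ∧ AnalyticOnNhd ℝ h W) ∧ ∀ ϖ ∈ Set.Icc (0:ℝ) 1, (m₀ : ℝ)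 + ∑ i, (m i : ℝ) * (∫ z in Set.pi Set.univ (fun _ : Fin (n i) => Set.Icc (0:ℝ) 1), g i (ϖ • z)) = ∫ z in Set.pi Set.univ (fun _ : Fin N => Set.Icc (0:ℝ) 1), h (ϖ • z))
    (h₂ : ∀ (N : ℕ) (h : (Fin N → ℝ) → ℝ) (W : Set (Fin N → ℝ)), IsOpen W → Set.pi Set.univ (fun _ : Fin N => Set.Icc (0:ℝ) 1) ⊆ W → Literature.NumberTheory.Transcendental.IsSemialgebraicFunOn ℚ W h → AnalyticOnNhd ℝ h W → (∫ z in Set.pi Set.univ (fun _ : Fin N => Set.Icc (0:ℝ) 1), h ((1:ℝ) • z)) = 0 → ∃ (ε : ℝ) (d₁ : ℕ) (K₁ : (Fin (d₁ + 1) → ℝ) → ℝ) (V₁ : Set (Fin (d₁ + 1) → ℝ)), 0 < ε ∧ IsOpen V₁ ∧ (∀ ϖ ∈ Set.Ioc (1 - ε) 1, ∀ x ∈ Set.pi Set.univ (fun _ : Fin d₁ => Set.Icc (0:ℝ) 1), Matrix.vecCons ϖ x ∈ V₁) ∧ Literature.NumberTheory.Transcendental.IsSemialgebraicFunOn ℚ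 V₁ K₁ ∧ AnalyticOnNhd ℝ K₁ V₁ ∧ ∀ ϖ ∈ Set.Ioc (1 - ε) 1, (∫ z in Set.pi Set.univ (fun _ : Fin N => Set.Icc (0:ℝ) 1), h (ϖ • z)) = (ϖ - 1) * ∫ y in Set.pi Set.univ (fun _ : Fin d₁ => Set.Icc (0:ℝ) 1), K₁ (Matrix.vecCons ϖ (ϖ • y)))
    (h₃ : ∀ (N : ℕ) (h : (Fin N → ℝ) → ℝ) (W : Set (Fin N → ℝ)), IsOpen W → Set.pi Set.univ (fun _ : Fin N => Set.Icc (0:ℝ) 1) ⊆ W → Literature.NumberTheory.Transcendental.IsSemialgebraicFunOn ℚ W h → AnalyticOnNhd ℝ h W → ∀ (ε : ℝ) (d₁ : ℕ) (K₁ : (Fin (d₁ + 1) → ℝ) → ℝ) (V₁ : Set (Fin (d₁ + 1) → ℝ)), 0 < ε → IsOpen V₁ → (∀ ϖ ∈ Set.Ioc (1 - ε) 1, ∀ x ∈ Set.pi Set.univ (fun _ : Fin d₁ => Set.Icc (0:ℝ) 1), Matrix.vecCons ϖ x ∈ V₁) → Literature.NumberTheory.Transcendental.IsSemialgebraicFunOn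 ℚ V₁ K₁ → AnalyticOnNhd ℝ K₁ V₁ → (∀ ϖ ∈ Set.Ioc (1 - ε) 1, (∫ z in Set.pi Set.univ (fun _ : Fin N => Set.Icc (0:ℝ) 1), h (ϖ • z)) = (ϖ - 1) * ∫ y in Set.pi Set.univ (fun _ : Fin d₁ => Set.Icc (0:ℝ) 1), K₁ (Matrix.vecCons ϖ (ϖ • y))) → ∃ (d : ℕ) (K : (Fin (d + 1) → ℝ) → ℝ) (V : Set (Fin (d + 1) → ℝ)), IsOpen V ∧ (∀ ϖ ∈ Set.Icc (0:ℝ) 1, ∀ x ∈ Set.pi Set.univ (fun _ : Fin d => Set.Icc (0:ℝ) 1), Matrix.vecCons ϖ x ∈ V) ∧ Literature.NumberTheory.Transcendental.IsSemialgebraicFunOn ℚ V K ∧ AnalyticOnNhd ℝ K V ∧ ∀ ϖ ∈ Set.Icc (0:ℝ) 1, (∫ z in Set.pi Set.univ (fun _ : Fin N => Set.Icc (0:ℝ) 1), h (ϖ • z)) = (ϖ - 1) * ∫ y in Set.pi Set.univ (fun _ : Fin d => Set.Icc (0:ℝ) 1), K (Matrix.vecCons ϖ (ϖ • y)))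
    (h₄ : ∀ (d : ℕ) (K : (Fin (d + 1) → ℝ) → ℝ) (V : Set (Fin (d + 1) → ℝ)), IsOpen V → (∀ ϖ ∈ Set.Icc (0:ℝ) 1, ∀ x ∈ Set.pi Set.univ (fun _ : Fin d => Set.Icc (0:ℝ) 1), Matrix.vecCons ϖ x ∈ V) → Literature.NumberTheory.Transcendental.IsSemialgebraicFunOn ℚ V K → AnalyticOnNhd ℝ K V → ∃ (G : (Fin (d + 1) → ℝ) → ℝ) (V' : Set (Fin (d + 1) → ℝ)), (IsOpen V' ∧ Set.pi Set.univ (fun _ : Fin (d + 1) => Set.Icc (0:ℝ) 1) ⊆ V' ∧ Literature.NumberTheory.Transcendental.IsSemialgebraicFunOn ℚ V' G ∧ AnalyticOnNhd ℝ G V') ∧ ∀ ϖ ∈ Set.Icc (0:ℝ) 1, (∫ y in Set.pi Set.univ (fun _ : Fin d => Set.Icc (0:ℝ) 1), K (Matrix.vecCons ϖ (ϖ • y))) = ∫ y' in Set.pi Set.univ (fun _ : Fin (d + 1) => Set.Icc (0:ℝ) 1), G (ϖ • y'))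
    (h₅ : ∀ (a b : ℝ), a < 0 → 1 < b → ∀ (ρ : ℝ → ℝ), Literature.NumberTheory.Transcendental.IsSemialgebraicFunOn ℚ {t : Fin 1 → ℝ | t 0 ∈ Set.Ioo a b} (fun t => ρ (t 0)) → (∀ x ∈ Set.Ioo a b, AnalyticAt ℝ ρ x) → ∀ (A : ℕ) (α c : Fin A → ℝ), (∀ k, IsAlgebraic ℚ (α k)) → (∀ k, IsAlgebraic ℚ (c k)) → (∀ k, α k ≤ a ∨ b ≤ α k) → (∫ z in Set.pi Set.univ (fun _ : Fin 1 => Set.Icc (0:ℝ) 1), (deriv ρ (((1:ℝ) • z) 0) + ∑ k, c k / (((1:ℝ) • z) 0 - α k))) = 0 → ∃ (K : (Fin 2 → ℝ) → ℝ) (V : Set (Fin 2 → ℝ)), IsOpen V ∧ (∀ ϖ ∈ Set.Icc (0:ℝ) 1, ∀ x ∈ Set.pi Set.univ (fun _ : Fin 1 => Set.Icc (0:ℝ) 1), Matrix.vecCons ϖ x ∈ V) ∧ Literature.NumberTheory.Transcendental.IsSemialgebraicFunOn ℚ V K ∧ AnalyticOnNhd ℝ K V ∧ ∀ ϖ ∈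 Set.Icc (0:ℝ) 1, (∫ z in Set.pi Set.univ (fun _ : Fin 1 => Set.Icc (0:ℝ) 1), (deriv ρ ((ϖ • z) 0) + ∑ k, c k / ((ϖ • z) 0 - α k))) = (ϖ - 1) * ∫ y in Set.pi Set.univ (fun _ : Fin 1 => Set.Icc (0:ℝ) 1), K (Matrix.vecCons ϖ (ϖ • y)))
    (h₆ : ∀ (a b : ℝ), a < 0 → 1 < b → ∀ (ρ : ℝ → ℝ), Literature.NumberTheory.Transcendental.IsSemialgebraicFunOn ℚ {t : Fin 1 → ℝ | t 0 ∈ Set.Ioo a b} (fun t => ρ (t 0)) → (∀ x ∈ Set.Ioo a b, AnalyticAt ℝ ρ x) → ∀ (A : ℕ) (p q γ δ : Fin A → ℝ), (∀ k, IsAlgebraic ℚ (p k)) → (∀ k, IsAlgebraic ℚ (q k)) → (∀ k, IsAlgebraic ℚ (γ k)) → (∀ k, IsAlgebraic ℚ (δ k)) → (∀ k, ∀ x ∈ Set.Ioo a b, 0 < 1 - p k * x ∨ q k * x ≠ 0) → (∫ z in Set.pi Set.univ (fun _ : Fin 1 => Set.Icc (0:ℝ) 1), (deriv ρ (((1:ℝ)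 • z) 0) + ∑ k, (γ k * (-p k + (p k ^ 2 + q k ^ 2) * (((1:ℝ) • z) 0)) + δ k * q k) / ((1 - p k * (((1:ℝ) • z) 0)) ^ 2 + (q k * (((1:ℝ) • z) 0)) ^ 2))) = 0 → ∃ (K : (Fin 2 → ℝ) → ℝ) (V : Set (Fin 2 → ℝ)), IsOpen V ∧ (∀ ϖ ∈ Set.Icc (0:ℝ) 1, ∀ x ∈ Set.pi Set.univ (fun _ : Fin 1 => Set.Icc (0:ℝ) 1), Matrix.vecCons ϖ x ∈ V) ∧ Literature.NumberTheory.Transcendental.IsSemialgebraicFunOn ℚ V K ∧ AnalyticOnNhd ℝ K V ∧ ∀ ϖ ∈ Set.Icc (0:ℝ) 1, (∫ z in Set.pi Set.univ (fun _ : Fin 1 => Set.Icc (0:ℝ) 1), (deriv ρ ((ϖ • z) 0) + ∑ k, (γ k * (-p k + (p k ^ 2 + q k ^ 2) * ((ϖ • z) 0)) + δ k * q k) / ((1 - p k * ((ϖ • z) 0)) ^ 2 + (q k * ((ϖ • z) 0)) ^ 2))) = (ϖ - 1) * ∫ y in Set.pi Set.univ (fun _ : Fin 1 => Set.Icc (0:ℝ)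 1), K (Matrix.vecCons ϖ (ϖ • y))) :
    ∀ (S : ℕ) (n : Fin S → ℕ) (g : (i : Fin S) → (Fin (n i) → ℝ) → ℝ) (U : (i : Fin S) → Set (Fin (n i) → ℝ)), (∀ i, IsOpen (U i) ∧ Set.pi Set.univ (fun _ : Fin (n i) => Set.Icc (0:ℝ) 1) ⊆ (U i) ∧ Literature.NumberTheory.Transcendental.IsSemialgebraicFunOn ℚ (U i) (g i) ∧ AnalyticOnNhd ℝ (g i) (U i)) → ∀ (m : Fin S → ℤ) (m₀ : ℤ), (m₀ : ℝ) + ∑ i, (m i : ℝ) * (∫ z in Set.pi Set.univ (fun _ : Fin (n i) => Set.Icc (0:ℝ) 1), g i ((1:ℝ) • z)) = 0 → ∃ (T : ℕ) (d : Fin T → ℕ) (G : (j : Fin T) → (Fin (d j) → ℝ) → ℝ) (V : (j : Fin T) → Set (Fin (d j) → ℝ)) (μ : Fin T → Polynomial ℝ) (μ₀ : Polynomial ℝ), (∀ j, IsOpen (V j) ∧ Set.pi Set.univ (fun _ : Fin (d j) => Set.Icc (0:ℝ) 1) ⊆ (V j) ∧ Literature.NumberTheory.Transcendental.IsSemialgebraicFunOn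 ℚ (V j) (G j) ∧ AnalyticOnNhd ℝ (G j) (V j)) ∧ (∀ j k, IsAlgebraic ℚ ((μ j).coeff k)) ∧ (∀ k, IsAlgebraic ℚ (μ₀.coeff k)) ∧ ∀ ϖ ∈ Set.Icc (0:ℝ) 1, (m₀ : ℝ) + ∑ i, (m i : ℝ) * (∫ z in Set.pi Set.univ (fun _ : Fin (n i) => Set.Icc (0:ℝ) 1), g i (ϖ • z)) = (ϖ - 1) * (μ₀.eval ϖ + ∑ j, (μ j).eval ϖ * (∫ z in Set.pi Set.univ (fun _ : Fin (d j) => Set.Icc (0:ℝ) 1), G j (ϖ • z))) := by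
  intro S n g U hg m m₀ hsum
  classical
  -- is the combination represented by COMPLEX Baker-sector data in dimension one?
  by_cases hP : ∃ (a b : ℝ) (ρ : ℝ → ℝ) (A : ℕ) (p q γ δ : Fin A → ℝ), a < 0 ∧ 1 < b ∧
      Literature.NumberTheory.Transcendental.IsSemialgebraicFunOn ℚ {t : Fin 1 → ℝ | t 0 ∈ Set.Ioo a b} (fun t => ρ (t 0)) ∧
      (∀ x ∈ Set.Ioo a b, AnalyticAt ℝ ρ x) ∧ (∀ k, IsAlgebraic ℚ (p k)) ∧ (∀ k, IsAlgebraic ℚ (q k)) ∧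
      (∀ k, IsAlgebraic ℚ (γ k)) ∧ (∀ k, IsAlgebraic ℚ (δ k)) ∧
      (∀ k, ∀ x ∈ Set.Ioo a b, 0 < 1 - p k * x ∨ q k * x ≠ 0) ∧
      ∀ ϖ ∈ Set.Icc (0:ℝ) 1, (m₀ : ℝ) + ∑ i, (m i : ℝ) *
          (∫ z in Set.pi Set.univ (fun _ : Fin (n i) => Set.Icc (0:ℝ) 1), g i (ϖ • z)) =
        ∫ z in Set.pi Set.univ (fun _ : Fin 1 => Set.Icc (0:ℝ) 1),
          (deriv ρ ((ϖ • z) 0) + ∑ k, (γ k * (-p k + (p k ^ 2 + q k ^ 2) * ((ϖ • z) 0)) + δ k * q k) /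
            ((1 - p k * ((ϖ • z) 0)) ^ 2 + (q k * ((ϖ • z) 0)) ^ 2))
  · obtain ⟨a, b, ρ, A, p, q, γ, δ, ha, hb, hρs, hρa, hp, hq, hγ, hδ, hslit, hrepr⟩ := hP
    have h1 : (∫ z in Set.pi Set.univ (fun _ : Fin 1 => Set.Icc (0:ℝ) 1),
        (deriv ρ (((1:ℝ) • z) 0) + ∑ k, (γ k * (-p k + (p k ^ 2 + q k ^ 2) * (((1:ℝ) • z) 0)) + δ k * q k) /
          ((1 - p k * (((1:ℝ) • z) 0)) ^ 2 + (q k * (((1:ℝ) • z) 0)) ^ 2))) = 0 := by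
      rw [← hrepr 1 ⟨zero_le_one, le_rfl⟩]
      exact hsum
    -- (S3″) the complex Baker-sector lift, one kernel on `[0,1]`
    obtain ⟨K, V, hVo, hVc, hKs, hKa, hid⟩ := h₆ a b ha hb ρ hρs hρa A p q γ δ hp hq hγ hδ hslit h1
    -- (S4) the twisted-diagonal integral is one dilation function `v_G`
    obtain ⟨G, V', hG, hGK⟩ := h₄ 1 K V hVo hVc hKs hKa
    refine ⟨1, fun _ => 1 + 1, fun _ => G, fun _ => V', fun _ => 1, 0, fun _ => hG, ?_, ?_, ?_⟩
    · intro j k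
      rw [Polynomial.coeff_one]
      split_ifs
      · exact isAlgebraic_one
      · exact isAlgebraic_zero
    · intro k
      rw [Polynomial.coeff_zero]
      exact isAlgebraic_zero
    · intro ϖ hϖ
      rw [hrepr ϖ hϖ, hid ϖ hϖ, hGK ϖ hϖ]
      simp
  · exact DilationLiftAtOne_of_stubs' h₁ h₂ h₃ h₄ h₅ S n g U hg m m₀ hsum

/-- **Decomposition theorem with the rational one-variable stub (RESHAPE 3, lead c2).** If the
integer combination's dilation function is that of one-variable RATIONAL KZ data, (S3‴) represents it
by complex Baker-sector data and (S3″)+(S4) settle it unconditionally; otherwise fall back to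
`DilationLiftAtOne_of_stubs''`. [cite: KontsevichZagier2001, §1.2] -/
theorem DilationLiftAtOne_of_stubs'''
    (h₁ : ∀ (S : ℕ) (n : Fin S → ℕ) (g : (i : Fin S) → (Fin (n i) → ℝ) → ℝ) (U : (i : Fin S) → Set (Fin (n i) → ℝ)), (∀ i, IsOpen (U i) ∧ Set.pi Set.univ (fun _ : Fin (n i) => Set.Icc (0:ℝ) 1) ⊆ (U i) ∧ Literature.NumberTheory.Transcendental.IsSemialgebraicFunOn ℚ (U i) (g i) ∧ AnalyticOnNhd ℝ (g i) (U i)) → ∀ (m : Fin S → ℤ) (m₀ : ℤ), ∃ (N : ℕ) (h : (Fin N → ℝ) → ℝ) (W : Set (Fin N → ℝ)), (IsOpen W ∧ Set.pi Set.univ (fun _ : Fin N => Set.Icc (0:ℝ) 1) ⊆ W ∧ Literature.NumberTheory.Transcendental.IsSemialgebraicFunOn ℚ W h ∧ AnalyticOnNhd ℝ h W) ∧ ∀ ϖ ∈ Set.Icc (0:ℝ) 1, (m₀ : ℝ) + ∑ i, (m i : ℝ) * (∫ z in Set.pi Set.univ (fun _ : Fin (n i) => Set.Icc (0:ℝ)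 1), g i (ϖ • z)) = ∫ z in Set.pi Set.univ (fun _ : Fin N => Set.Icc (0:ℝ) 1), h (ϖ • z))
    (h₂ : ∀ (N : ℕ) (h : (Fin N → ℝ) → ℝ) (W : Set (Fin N → ℝ)), IsOpen W → Set.pi Set.univ (fun _ : Fin N => Set.Icc (0:ℝ) 1) ⊆ W → Literature.NumberTheory.Transcendental.IsSemialgebraicFunOn ℚ W h → AnalyticOnNhd ℝ h W → (∫ z in Set.pi Set.univ (fun _ : Fin N => Set.Icc (0:ℝ) 1), h ((1:ℝ) • z)) = 0 → ∃ (ε : ℝ) (d₁ : ℕ) (K₁ : (Fin (d₁ + 1) → ℝ) → ℝ) (V₁ : Set (Fin (d₁ + 1) → ℝ)), 0 < ε ∧ IsOpen V₁ ∧ (∀ ϖ ∈ Set.Ioc (1 - ε) 1, ∀ x ∈ Set.pi Set.univ (fun _ : Fin d₁ => Set.Icc (0:ℝ) 1), Matrix.vecCons ϖ x ∈ V₁) ∧ Literature.NumberTheory.Transcendental.IsSemialgebraicFunOn ℚ V₁ K₁ ∧ AnalyticOnNhd ℝ K₁ V₁ ∧ ∀ ϖ ∈ Set.Ioc (1 -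 ε) 1, (∫ z in Set.pi Set.univ (fun _ : Fin N => Set.Icc (0:ℝ) 1), h (ϖ • z)) = (ϖ - 1) * ∫ y in Set.pi Set.univ (fun _ : Fin d₁ => Set.Icc (0:ℝ) 1), K₁ (Matrix.vecCons ϖ (ϖ • y)))
    (h₃ : ∀ (N : ℕ) (h : (Fin N → ℝ) → ℝ) (W : Set (Fin N → ℝ)), IsOpen W → Set.pi Set.univ (fun _ : Fin N => Set.Icc (0:ℝ) 1) ⊆ W → Literature.NumberTheory.Transcendental.IsSemialgebraicFunOn ℚ W h → AnalyticOnNhd ℝ h W → ∀ (ε : ℝ) (d₁ : ℕ) (K₁ : (Fin (d₁ + 1) → ℝ) → ℝ) (V₁ : Set (Fin (d₁ + 1) → ℝ)), 0 < ε → IsOpen V₁ → (∀ ϖ ∈ Set.Ioc (1 - ε) 1, ∀ x ∈ Set.pi Set.univ (fun _ : Fin d₁ => Set.Icc (0:ℝ) 1), Matrix.vecCons ϖ x ∈ V₁) → Literature.NumberTheory.Transcendental.IsSemialgebraicFunOn ℚ V₁ K₁ → AnalyticOnNhd ℝ K₁ V₁ → (∀ ϖ ∈ Set.Ioc (1 -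 ε) 1, (∫ z in Set.pi Set.univ (fun _ : Fin N => Set.Icc (0:ℝ) 1), h (ϖ • z)) = (ϖ - 1) * ∫ y in Set.pi Set.univ (fun _ : Fin d₁ => Set.Icc (0:ℝ) 1), K₁ (Matrix.vecCons ϖ (ϖ • y))) → ∃ (d : ℕ) (K : (Fin (d + 1) → ℝ) → ℝ) (V : Set (Fin (d + 1) → ℝ)), IsOpen V ∧ (∀ ϖ ∈ Set.Icc (0:ℝ) 1, ∀ x ∈ Set.pi Set.univ (fun _ : Fin d => Set.Icc (0:ℝ) 1), Matrix.vecCons ϖ x ∈ V) ∧ Literature.NumberTheory.Transcendental.IsSemialgebraicFunOn ℚ V K ∧ AnalyticOnNhd ℝ K V ∧ ∀ ϖ ∈ Set.Icc (0:ℝ) 1, (∫ z in Set.pi Set.univ (fun _ : Fin N => Set.Icc (0:ℝ) 1), h (ϖ • z)) = (ϖ - 1) * ∫ y in Set.pi Set.univ (fun _ : Fin d => Set.Icc (0:ℝ) 1), K (Matrix.vecCons ϖ (ϖ • y)))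
    (h₄ : ∀ (d : ℕ) (K : (Fin (d + 1) → ℝ) → ℝ) (V : Set (Fin (d + 1) → ℝ)), IsOpen V → (∀ ϖ ∈ Set.Icc (0:ℝ) 1, ∀ x ∈ Set.pi Set.univ (fun _ : Fin d => Set.Icc (0:ℝ) 1), Matrix.vecCons ϖ x ∈ V) → Literature.NumberTheory.Transcendental.IsSemialgebraicFunOn ℚ V K → AnalyticOnNhd ℝ K V → ∃ (G : (Fin (d + 1) → ℝ) → ℝ) (V' : Set (Fin (d + 1) → ℝ)), (IsOpen V' ∧ Set.pi Set.univ (fun _ : Fin (d + 1) => Set.Icc (0:ℝ) 1) ⊆ V' ∧ Literature.NumberTheory.Transcendental.IsSemialgebraicFunOn ℚ V' G ∧ AnalyticOnNhd ℝ G V') ∧ ∀ ϖ ∈ Set.Icc (0:ℝ) 1, (∫ y in Set.pi Set.univ (fun _ : Fin d => Set.Icc (0:ℝ) 1), K (Matrix.vecCons ϖ (ϖ • y))) = ∫ y' in Set.pi Set.univ (fun _ : Fin (d + 1) => Set.Icc (0:ℝ) 1), G (ϖ • y'))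
    (h₅ : ∀ (a b : ℝ), a < 0 → 1 < b → ∀ (ρ : ℝ → ℝ), Literature.NumberTheory.Transcendental.IsSemialgebraicFunOn ℚ {t : Fin 1 → ℝ | t 0 ∈ Set.Ioo a b} (fun t => ρ (t 0)) → (∀ x ∈ Set.Ioo a b, AnalyticAt ℝ ρ x) → ∀ (A : ℕ) (α c : Fin A → ℝ), (∀ k, IsAlgebraic ℚ (α k)) → (∀ k, IsAlgebraic ℚ (c k)) → (∀ k, α k ≤ a ∨ b ≤ α k) → (∫ z in Set.pi Set.univ (fun _ : Fin 1 => Set.Icc (0:ℝ) 1), (deriv ρ (((1:ℝ) • z) 0) + ∑ k, c k / (((1:ℝ) • z) 0 - α k))) = 0 → ∃ (K : (Fin 2 → ℝ) → ℝ) (V : Set (Fin 2 → ℝ)), IsOpen V ∧ (∀ ϖ ∈ Set.Icc (0:ℝ) 1, ∀ x ∈ Set.pi Set.univ (fun _ : Fin 1 => Set.Icc (0:ℝ) 1), Matrix.vecCons ϖ x ∈ V) ∧ Literature.NumberTheory.Transcendental.IsSemialgebraicFunOn ℚ V K ∧ AnalyticOnNhd ℝ K V ∧ ∀ ϖ ∈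 Set.Icc (0:ℝ) 1, (∫ z in Set.pi Set.univ (fun _ : Fin 1 => Set.Icc (0:ℝ) 1), (deriv ρ ((ϖ • z) 0) + ∑ k, c k / ((ϖ • z) 0 - α k))) = (ϖ - 1) * ∫ y in Set.pi Set.univ (fun _ : Fin 1 => Set.Icc (0:ℝ) 1), K (Matrix.vecCons ϖ (ϖ • y)))
    (h₆ : ∀ (a b : ℝ), a < 0 → 1 < b → ∀ (ρ : ℝ → ℝ), Literature.NumberTheory.Transcendental.IsSemialgebraicFunOn ℚ {t : Fin 1 → ℝ | t 0 ∈ Set.Ioo a b} (fun t => ρ (t 0)) → (∀ x ∈ Set.Ioo a b, AnalyticAt ℝ ρ x) → ∀ (A : ℕ) (p q γ δ : Fin A → ℝ), (∀ k, IsAlgebraic ℚ (p k)) → (∀ k, IsAlgebraic ℚ (q k)) → (∀ k, IsAlgebraic ℚ (γ k)) → (∀ k, IsAlgebraic ℚ (δ k)) → (∀ k, ∀ x ∈ Set.Ioo a b, 0 < 1 - p k * x ∨ q k * x ≠ 0) → (∫ z in Set.pi Set.univ (fun _ : Fin 1 => Set.Icc (0:ℝ) 1), (deriv ρ (((1:ℝ)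 • z) 0) + ∑ k, (γ k * (-p k + (p k ^ 2 + q k ^ 2) * (((1:ℝ) • z) 0)) + δ k * q k) / ((1 - p k * (((1:ℝ) • z) 0)) ^ 2 + (q k * (((1:ℝ) • z) 0)) ^ 2))) = 0 → ∃ (K : (Fin 2 → ℝ) → ℝ) (V : Set (Fin 2 → ℝ)), IsOpen V ∧ (∀ ϖ ∈ Set.Icc (0:ℝ) 1, ∀ x ∈ Set.pi Set.univ (fun _ : Fin 1 => Set.Icc (0:ℝ) 1), Matrix.vecCons ϖ x ∈ V) ∧ Literature.NumberTheory.Transcendental.IsSemialgebraicFunOn ℚ V K ∧ AnalyticOnNhd ℝ K V ∧ ∀ ϖ ∈ Set.Icc (0:ℝ) 1, (∫ z in Set.pi Set.univ (fun _ : Fin 1 => Set.Icc (0:ℝ) 1), (deriv ρ ((ϖ • z) 0) + ∑ k, (γ k * (-p k + (p k ^ 2 + q k ^ 2) * ((ϖ • z) 0)) + δ k * q k) / ((1 - p k * ((ϖ • z) 0)) ^ 2 + (q k * ((ϖ • z) 0)) ^ 2))) = (ϖ - 1) * ∫ y in Set.pi Set.univ (fun _ : Fin 1 => Set.Icc (0:ℝ)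 1), K (Matrix.vecCons ϖ (ϖ • y)))
    (h₇ : ∀ (S : ℕ) (P Q : Fin S → Polynomial ℚ) (a b : ℚ), (a:ℝ) < 0 → 1 < (b:ℝ) → (∀ i, ∀ x ∈ Set.Ioo (a:ℝ) b, Polynomial.aeval x (Q i) ≠ 0) → ∀ (m : Fin S → ℤ) (m₀ : ℤ), ∃ (ρ : ℝ → ℝ) (A : ℕ) (p q γ δ : Fin A → ℝ), Literature.NumberTheory.Transcendental.IsSemialgebraicFunOn ℚ {t : Fin 1 → ℝ | t 0 ∈ Set.Ioo (a:ℝ) b} (fun t => ρ (t 0)) ∧ (∀ x ∈ Set.Ioo (a:ℝ) b, AnalyticAt ℝ ρ x) ∧ (∀ k, IsAlgebraic ℚ (p k)) ∧ (∀ k, IsAlgebraic ℚ (q k)) ∧ (∀ k, IsAlgebraic ℚ (γ k)) ∧ (∀ k, IsAlgebraic ℚ (δ k)) ∧ (∀ k, ∀ x ∈ Set.Ioo (a:ℝ) b, 0 < 1 - p k * x ∨ q k * x ≠ 0) ∧ ∀ ϖ ∈ Set.Icc (0:ℝ) 1, (m₀ : ℝ) + ∑ i, (m i : ℝ) * (∫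 z in Set.pi Set.univ (fun _ : Fin 1 => Set.Icc (0:ℝ) 1), Polynomial.aeval ((ϖ • z) 0) (P i) / Polynomial.aeval ((ϖ • z) 0) (Q i)) = ∫ z in Set.pi Set.univ (fun _ : Fin 1 => Set.Icc (0:ℝ) 1), (deriv ρ ((ϖ • z) 0) + ∑ k, (γ k * (-p k + (p k ^ 2 + q k ^ 2) * ((ϖ • z) 0)) + δ k * q k) / ((1 - p k * ((ϖ • z) 0)) ^ 2 + (q k * ((ϖ • z) 0)) ^ 2))) :
    ∀ (S : ℕ) (n : Fin S → ℕ) (g : (i : Fin S) → (Fin (n i) → ℝ) → ℝ) (U : (i : Fin S) → Set (Fin (n i) → ℝ)), (∀ i, IsOpen (U i) ∧ Set.pi Set.univ (fun _ : Fin (n i) => Set.Icc (0:ℝ) 1) ⊆ (U i) ∧ Literature.NumberTheory.Transcendental.IsSemialgebraicFunOn ℚ (U i) (g i) ∧ AnalyticOnNhd ℝ (g i) (U i)) → ∀ (m : Fin S → ℤ) (m₀ : ℤ), (m₀ : ℝ) + ∑ i, (m i : ℝ) * (∫ z in Set.pi Set.univ (fun _ : Fin (n i) => Set.Icc (0:ℝ)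 1), g i ((1:ℝ) • z)) = 0 → ∃ (T : ℕ) (d : Fin T → ℕ) (G : (j : Fin T) → (Fin (d j) → ℝ) → ℝ) (V : (j : Fin T) → Set (Fin (d j) → ℝ)) (μ : Fin T → Polynomial ℝ) (μ₀ : Polynomial ℝ), (∀ j, IsOpen (V j) ∧ Set.pi Set.univ (fun _ : Fin (d j) => Set.Icc (0:ℝ) 1) ⊆ (V j) ∧ Literature.NumberTheory.Transcendental.IsSemialgebraicFunOn ℚ (V j) (G j) ∧ AnalyticOnNhd ℝ (G j) (V j)) ∧ (∀ j k, IsAlgebraic ℚ ((μ j).coeff k)) ∧ (∀ k, IsAlgebraic ℚ (μ₀.coeff k)) ∧ ∀ ϖ ∈ Set.Icc (0:ℝ) 1, (m₀ : ℝ) + ∑ i, (m i : ℝ) * (∫ z in Set.pi Set.univ (fun _ : Fin (n i) => Set.Icc (0:ℝ) 1), g i (ϖ • z)) = (ϖ - 1) * (μ₀.eval ϖ + ∑ j, (μ j).eval ϖ * (∫ z in Set.pi Set.univ (fun _ : Fin (d j) => Set.Icc (0:ℝ) 1), G j (ϖ • z))) := by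

  intro S n g U hg m m₀ hsum
  classical
  -- is the combination's dilation function that of one-variable RATIONAL data?
  by_cases hR : ∃ (P Q : Fin S → Polynomial ℚ) (a b : ℚ), (a:ℝ) < 0 ∧ 1 < (b:ℝ) ∧
      (∀ i, ∀ x ∈ Set.Ioo (a:ℝ) b, Polynomial.aeval x (Q i) ≠ 0) ∧
      ∀ ϖ ∈ Set.Icc (0:ℝ) 1, (m₀ : ℝ) + ∑ i, (m i : ℝ) *
          (∫ z in Set.pi Set.univ (fun _ : Fin (n i) => Set.Icc (0:ℝ) 1), g i (ϖ • z)) =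
        (m₀ : ℝ) + ∑ i, (m i : ℝ) * (∫ z in Set.pi Set.univ (fun _ : Fin 1 => Set.Icc (0:ℝ) 1),
          Polynomial.aeval ((ϖ • z) 0) (P i) / Polynomial.aeval ((ϖ • z) 0) (Q i))
  · obtain ⟨P, Q, a, b, ha, hb, hQ, hR⟩ := hR
    -- (S3‴) the rational data are complex Baker-sector data
    obtain ⟨ρ, A, p, q, γ, δ, hρs, hρa, hp, hq, hγ, hδ, hslit, hrepr⟩ := h₇ S P Q a b ha hb hQ m m₀
    have h1 : (∫ z in Set.pi Set.univ (fun _ : Fin 1 => Set.Icc (0:ℝ) 1),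
        (deriv ρ (((1:ℝ) • z) 0) + ∑ k, (γ k * (-p k + (p k ^ 2 + q k ^ 2) * (((1:ℝ) • z) 0)) + δ k * q k) /
          ((1 - p k * (((1:ℝ) • z) 0)) ^ 2 + (q k * (((1:ℝ) • z) 0)) ^ 2))) = 0 := by
      rw [← hrepr 1 ⟨zero_le_one, le_rfl⟩, ← hR 1 ⟨zero_le_one, le_rfl⟩]
      exact hsum
    -- (S3″) the complex Baker-sector lift, one kernel on `[0,1]`
    obtain ⟨K, V, hVo, hVc, hKs, hKa, hid⟩ := h₆ a b ha hb ρ hρs hρa A p q γ δ hp hq hγ hδ hslit h1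
    -- (S4) the twisted-diagonal integral is one dilation function `v_G`
    obtain ⟨G, V', hG, hGK⟩ := h₄ 1 K V hVo hVc hKs hKa
    refine ⟨1, fun _ => 1 + 1, fun _ => G, fun _ => V', fun _ => 1, 0, fun _ => hG, ?_, ?_, ?_⟩
    · intro j k
      rw [Polynomial.coeff_one]
      split_ifs
      · exact isAlgebraic_one
      · exact isAlgebraic_zero
    · intro k
      rw [Polynomial.coeff_zero]
      exact isAlgebraic_zero
    · intro ϖ hϖ
      rw [hR ϖ hϖ, hrepr ϖ hϖ, hid ϖ hϖ, hGK ϖ hϖ]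
      simp
  · exact DilationLiftAtOne_of_stubs'' h₁ h₂ h₃ h₄ h₅ h₆ S n g U hg m m₀ hsum

/-- **Decomposition theorem with the two-variable Stokes stub (RESHAPE 4, lead c2).** If the
integer combination's dilation function is that of two-variable `x₀`-EXACT RATIONAL data
`h_i = ∂₀(P_i/Q_i)`, (S3⁗) descends it to one-variable rational data plus `(ϖ − 1)`·(twisted Nash
kernels), (S3‴)+(S3″) lift the one-variable part and (S4) turns every kernel into a dilation function;
otherwise fall back to `DilationLiftAtOne_of_stubs'''`. [cite: KontsevichZagier2001, §1.2] -/
theorem DilationLiftAtOne_of_stubs''''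
    (h₁ : ∀ (S : ℕ) (n : Fin S → ℕ) (g : (i : Fin S) → (Fin (n i) → ℝ) → ℝ) (U : (i : Fin S) → Set (Fin (n i) → ℝ)), (∀ i, IsOpen (U i) ∧ Set.pi Set.univ (fun _ : Fin (n i) => Set.Icc (0:ℝ) 1) ⊆ (U i) ∧ Literature.NumberTheory.Transcendental.IsSemialgebraicFunOn ℚ (U i) (g i) ∧ AnalyticOnNhd ℝ (g i) (U i)) → ∀ (m : Fin S → ℤ) (m₀ : ℤ), ∃ (N : ℕ) (h : (Fin N → ℝ) → ℝ) (W : Set (Fin N → ℝ)), (IsOpen W ∧ Set.pi Set.univ (fun _ : Fin N => Set.Icc (0:ℝ) 1) ⊆ W ∧ Literature.NumberTheory.Transcendental.IsSemialgebraicFunOn ℚ W h ∧ AnalyticOnNhd ℝ h W) ∧ ∀ ϖ ∈ Set.Icc (0:ℝ) 1, (m₀ : ℝ) + ∑ i, (m i : ℝ) * (∫ z in Set.pi Set.univ (fun _ : Fin (n i) => Set.Icc (0:ℝ) 1), g i (ϖ • z)) = ∫ z in Set.pi Set.univ (fun _ : Fin N => Set.Icc (0:ℝ) 1), h (ϖ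 • z))
    (h₂ : ∀ (N : ℕ) (h : (Fin N → ℝ) → ℝ) (W : Set (Fin N → ℝ)), IsOpen W → Set.pi Set.univ (fun _ : Fin N => Set.Icc (0:ℝ) 1) ⊆ W → Literature.NumberTheory.Transcendental.IsSemialgebraicFunOn ℚ W h → AnalyticOnNhd ℝ h W → (∫ z in Set.pi Set.univ (fun _ : Fin N => Set.Icc (0:ℝ) 1), h ((1:ℝ) • z)) = 0 → ∃ (ε : ℝ) (d₁ : ℕ) (K₁ : (Fin (d₁ + 1) → ℝ) → ℝ) (V₁ : Set (Fin (d₁ + 1) → ℝ)), 0 < ε ∧ IsOpen V₁ ∧ (∀ ϖ ∈ Set.Ioc (1 - ε) 1, ∀ x ∈ Set.pi Set.univ (fun _ : Fin d₁ => Set.Icc (0:ℝ) 1), Matrix.vecCons ϖ x ∈ V₁) ∧ Literature.NumberTheory.Transcendental.IsSemialgebraicFunOn ℚ V₁ K₁ ∧ AnalyticOnNhd ℝ K₁ V₁ ∧ ∀ ϖ ∈ Set.Ioc (1 - ε) 1, (∫ z in Set.pi Set.univ (fun _ : Fin N => Set.Icc (0:ℝ) 1), h (ϖ • z)) = (ϖ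 - 1) * ∫ y in Set.pi Set.univ (fun _ : Fin d₁ => Set.Icc (0:ℝ) 1), K₁ (Matrix.vecCons ϖ (ϖ • y)))
    (h₃ : ∀ (N : ℕ) (h : (Fin N → ℝ) → ℝ) (W : Set (Fin N → ℝ)), IsOpen W → Set.pi Set.univ (fun _ : Fin N => Set.Icc (0:ℝ) 1) ⊆ W → Literature.NumberTheory.Transcendental.IsSemialgebraicFunOn ℚ W h → AnalyticOnNhd ℝ h W → ∀ (ε : ℝ) (d₁ : ℕ) (K₁ : (Fin (d₁ + 1) → ℝ) → ℝ) (V₁ : Set (Fin (d₁ + 1) → ℝ)), 0 < ε → IsOpen V₁ → (∀ ϖ ∈ Set.Ioc (1 - ε) 1, ∀ x ∈ Set.pi Set.univ (fun _ : Fin d₁ => Set.Icc (0:ℝ) 1), Matrix.vecCons ϖ x ∈ V₁) → Literature.NumberTheory.Transcendental.IsSemialgebraicFunOn ℚ V₁ K₁ → AnalyticOnNhd ℝ K₁ V₁ → (∀ ϖ ∈ Set.Ioc (1 - ε) 1, (∫ z in Set.pi Set.univ (fun _ : Fin N => Set.Icc (0:ℝ) 1), h (ϖ • z)) = (ϖ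 - 1) * ∫ y in Set.pi Set.univ (fun _ : Fin d₁ => Set.Icc (0:ℝ) 1), K₁ (Matrix.vecCons ϖ (ϖ • y))) → ∃ (d : ℕ) (K : (Fin (d + 1) → ℝ) → ℝ) (V : Set (Fin (d + 1) → ℝ)), IsOpen V ∧ (∀ ϖ ∈ Set.Icc (0:ℝ) 1, ∀ x ∈ Set.pi Set.univ (fun _ : Fin d => Set.Icc (0:ℝ) 1), Matrix.vecCons ϖ x ∈ V) ∧ Literature.NumberTheory.Transcendental.IsSemialgebraicFunOn ℚ V K ∧ AnalyticOnNhd ℝ K V ∧ ∀ ϖ ∈ Set.Icc (0:ℝ) 1, (∫ z in Set.pi Set.univ (fun _ : Fin N => Set.Icc (0:ℝ) 1), h (ϖ • z)) = (ϖ - 1) * ∫ y in Set.pi Set.univ (fun _ : Fin d => Set.Icc (0:ℝ) 1), K (Matrix.vecCons ϖ (ϖ • y)))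
    (h₄ : ∀ (d : ℕ) (K : (Fin (d + 1) → ℝ) → ℝ) (V : Set (Fin (d + 1) → ℝ)), IsOpen V → (∀ ϖ ∈ Set.Icc (0:ℝ) 1, ∀ x ∈ Set.pi Set.univ (fun _ : Fin d => Set.Icc (0:ℝ) 1), Matrix.vecCons ϖ x ∈ V) → Literature.NumberTheory.Transcendental.IsSemialgebraicFunOn ℚ V K → AnalyticOnNhd ℝ K V → ∃ (G : (Fin (d + 1) → ℝ) → ℝ) (V' : Set (Fin (d + 1) → ℝ)), (IsOpen V' ∧ Set.pi Set.univ (fun _ : Fin (d + 1) => Set.Icc (0:ℝ) 1) ⊆ V' ∧ Literature.NumberTheory.Transcendental.IsSemialgebraicFunOn ℚ V' G ∧ AnalyticOnNhd ℝ G V') ∧ ∀ ϖ ∈ Set.Icc (0:ℝ) 1, (∫ y in Set.pi Set.univ (fun _ : Fin d => Set.Icc (0:ℝ) 1), K (Matrix.vecCons ϖ (ϖ • y))) = ∫ y' in Set.pi Set.univ (fun _ : Fin (d + 1) => Set.Icc (0:ℝ) 1), G (ϖ • y'))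
    (h₅ : ∀ (a b : ℝ), a < 0 → 1 < b → ∀ (ρ : ℝ → ℝ), Literature.NumberTheory.Transcendental.IsSemialgebraicFunOn ℚ {t : Fin 1 → ℝ | t 0 ∈ Set.Ioo a b} (fun t => ρ (t 0)) → (∀ x ∈ Set.Ioo a b, AnalyticAt ℝ ρ x) → ∀ (A : ℕ) (α c : Fin A → ℝ), (∀ k, IsAlgebraic ℚ (α k)) → (∀ k, IsAlgebraic ℚ (c k)) → (∀ k, α k ≤ a ∨ b ≤ α k) → (∫ z in Set.pi Set.univ (fun _ : Fin 1 => Set.Icc (0:ℝ) 1), (deriv ρ (((1:ℝ) • z) 0) + ∑ k, c k / (((1:ℝ) • z) 0 - α k))) = 0 → ∃ (K : (Fin 2 → ℝ) → ℝ) (V : Set (Fin 2 → ℝ)), IsOpen V ∧ (∀ ϖ ∈ Set.Icc (0:ℝ) 1, ∀ x ∈ Set.pi Set.univ (fun _ : Fin 1 => Set.Icc (0:ℝ) 1), Matrix.vecCons ϖ x ∈ V) ∧ Literature.NumberTheory.Transcendental.IsSemialgebraicFunOn ℚ V K ∧ AnalyticOnNhd ℝ K V ∧ ∀ ϖ ∈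 Set.Icc (0:ℝ) 1, (∫ z in Set.pi Set.univ (fun _ : Fin 1 => Set.Icc (0:ℝ) 1), (deriv ρ ((ϖ • z) 0) + ∑ k, c k / ((ϖ • z) 0 - α k))) = (ϖ - 1) * ∫ y in Set.pi Set.univ (fun _ : Fin 1 => Set.Icc (0:ℝ) 1), K (Matrix.vecCons ϖ (ϖ • y)))
    (h₆ : ∀ (a b : ℝ), a < 0 → 1 < b → ∀ (ρ : ℝ → ℝ), Literature.NumberTheory.Transcendental.IsSemialgebraicFunOn ℚ {t : Fin 1 → ℝ | t 0 ∈ Set.Ioo a b} (fun t => ρ (t 0)) → (∀ x ∈ Set.Ioo a b, AnalyticAt ℝ ρ x) → ∀ (A : ℕ) (p q γ δ : Fin A → ℝ), (∀ k, IsAlgebraic ℚ (p k)) → (∀ k, IsAlgebraic ℚ (q k)) → (∀ k, IsAlgebraic ℚ (γ k)) → (∀ k, IsAlgebraic ℚ (δ k)) → (∀ k, ∀ x ∈ Set.Ioo a b, 0 < 1 - p k * x ∨ q k * x ≠ 0) → (∫ z in Set.pi Set.univ (fun _ : Fin 1 => Set.Icc (0:ℝ) 1), (deriv ρ (((1:ℝ)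 • z) 0) + ∑ k, (γ k * (-p k + (p k ^ 2 + q k ^ 2) * (((1:ℝ) • z) 0)) + δ k * q k) / ((1 - p k * (((1:ℝ) • z) 0)) ^ 2 + (q k * (((1:ℝ) • z) 0)) ^ 2))) = 0 → ∃ (K : (Fin 2 → ℝ) → ℝ) (V : Set (Fin 2 → ℝ)), IsOpen V ∧ (∀ ϖ ∈ Set.Icc (0:ℝ) 1, ∀ x ∈ Set.pi Set.univ (fun _ : Fin 1 => Set.Icc (0:ℝ) 1), Matrix.vecCons ϖ x ∈ V) ∧ Literature.NumberTheory.Transcendental.IsSemialgebraicFunOn ℚ V K ∧ AnalyticOnNhd ℝ K V ∧ ∀ ϖ ∈ Set.Icc (0:ℝ) 1, (∫ z in Set.pi Set.univ (fun _ : Fin 1 => Set.Icc (0:ℝ) 1), (deriv ρ ((ϖ • z) 0) + ∑ k, (γ k * (-p k + (p k ^ 2 + q k ^ 2) * ((ϖ • z) 0)) + δ k * q k) / ((1 - p k * ((ϖ • z) 0)) ^ 2 + (q k * ((ϖ • z) 0)) ^ 2))) = (ϖ - 1) * ∫ y in Set.pi Set.univ (fun _ : Fin 1 => Set.Icc (0:ℝ)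 1), K (Matrix.vecCons ϖ (ϖ • y)))
    (h₇ : ∀ (S : ℕ) (P Q : Fin S → Polynomial ℚ) (a b : ℚ), (a:ℝ) < 0 → 1 < (b:ℝ) → (∀ i, ∀ x ∈ Set.Ioo (a:ℝ) b, Polynomial.aeval x (Q i) ≠ 0) → ∀ (m : Fin S → ℤ) (m₀ : ℤ), ∃ (ρ : ℝ → ℝ) (A : ℕ) (p q γ δ : Fin A → ℝ), Literature.NumberTheory.Transcendental.IsSemialgebraicFunOn ℚ {t : Fin 1 → ℝ | t 0 ∈ Set.Ioo (a:ℝ) b} (fun t => ρ (t 0)) ∧ (∀ x ∈ Set.Ioo (a:ℝ) b, AnalyticAt ℝ ρ x) ∧ (∀ k, IsAlgebraic ℚ (p k)) ∧ (∀ k, IsAlgebraic ℚ (q k)) ∧ (∀ k, IsAlgebraic ℚ (γ k)) ∧ (∀ k, IsAlgebraic ℚ (δ k)) ∧ (∀ k, ∀ x ∈ Set.Ioo (a:ℝ) b, 0 < 1 - p k * x ∨ q k * x ≠ 0) ∧ ∀ ϖ ∈ Set.Icc (0:ℝ) 1, (m₀ : ℝ) + ∑ i, (m i : ℝ) * (∫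 z in Set.pi Set.univ (fun _ : Fin 1 => Set.Icc (0:ℝ) 1), Polynomial.aeval ((ϖ • z) 0) (P i) / Polynomial.aeval ((ϖ • z) 0) (Q i)) = ∫ z in Set.pi Set.univ (fun _ : Fin 1 => Set.Icc (0:ℝ) 1), (deriv ρ ((ϖ • z) 0) + ∑ k, (γ k * (-p k + (p k ^ 2 + q k ^ 2) * ((ϖ • z) 0)) + δ k * q k) / ((1 - p k * ((ϖ • z) 0)) ^ 2 + (q k * ((ϖ • z) 0)) ^ 2)))
    (h₈ : ∀ (S : ℕ) (P Q : Fin S → MvPolynomial (Fin 2) ℚ) (a b : ℚ), (a:ℝ) < 0 → 1 < (b:ℝ) → (∀ i, ∀ p ∈ Set.pi Set.univ (fun _ : Fin 2 => Set.Ioo (a:ℝ) b), MvPolynomial.aeval p (Q i) ≠ 0) → ∃ (Kn Kd : Fin S → Polynomial ℚ) (K : Fin S → (Fin 2 → ℝ) → ℝ) (V : Set (Fin 2 → ℝ)), (∀ i, ∀ x ∈ Set.Ioo (a:ℝ) b, Polynomial.aeval x (Kd i) ≠ 0) ∧ IsOpen V ∧ (∀ ϖ ∈ Set.Icc (0:ℝ)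 1, ∀ x ∈ Set.pi Set.univ (fun _ : Fin 1 => Set.Icc (0:ℝ) 1), Matrix.vecCons ϖ x ∈ V) ∧ (∀ i, Literature.NumberTheory.Transcendental.IsSemialgebraicFunOn ℚ V (K i)) ∧ (∀ i, AnalyticOnNhd ℝ (K i) V) ∧ ∀ i, ∀ ϖ ∈ Set.Icc (0:ℝ) 1, (∫ z in Set.pi Set.univ (fun _ : Fin 2 => Set.Icc (0:ℝ) 1), (MvPolynomial.aeval (ϖ • z) (MvPolynomial.pderiv 0 (P i)) * MvPolynomial.aeval (ϖ • z) (Q i) - MvPolynomial.aeval (ϖ • z) (P i) * MvPolynomial.aeval (ϖ • z) (MvPolynomial.pderiv 0 (Q i))) / (MvPolynomial.aeval (ϖ • z) (Q i)) ^ 2) = (∫ z in Set.pi Set.univ (fun _ : Fin 1 => Set.Icc (0:ℝ) 1), Polynomial.aeval ((ϖ • z) 0) (Kn i) / Polynomial.aeval ((ϖ • z) 0) (Kd i)) + (ϖ - 1) * ∫ y in Set.pi Set.univ (fun _ : Fin 1 => Set.Icc (0:ℝ) 1), K i (Matrix.vecCons ϖ (ϖ • y))) :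
    ∀ (S : ℕ) (n : Fin S → ℕ) (g : (i : Fin S) → (Fin (n i) → ℝ) → ℝ) (U : (i : Fin S) → Set (Fin (n i) → ℝ)), (∀ i, IsOpen (U i) ∧ Set.pi Set.univ (fun _ : Fin (n i) => Set.Icc (0:ℝ) 1) ⊆ (U i) ∧ Literature.NumberTheory.Transcendental.IsSemialgebraicFunOn ℚ (U i) (g i) ∧ AnalyticOnNhd ℝ (g i) (U i)) → ∀ (m : Fin S → ℤ) (m₀ : ℤ), (m₀ : ℝ) + ∑ i, (m i : ℝ) * (∫ z in Set.pi Set.univ (fun _ : Fin (n i) => Set.Icc (0:ℝ) 1), g i ((1:ℝ) • z)) = 0 → ∃ (T : ℕ) (d : Fin T → ℕ) (G : (j : Fin T) → (Fin (d j) → ℝ) → ℝ) (V : (j : Fin T) → Set (Fin (d j) → ℝ)) (μ : Fin T → Polynomial ℝ) (μ₀ : Polynomial ℝ), (∀ j, IsOpen (V j) ∧ Set.pi Set.univ (fun _ : Fin (d j) => Set.Icc (0:ℝ) 1) ⊆ (V j) ∧ Literature.NumberTheory.Transcendental.IsSemialgebraicFunOn ℚ (V j) (G j) ∧ AnalyticOnNhd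 ℝ (G j) (V j)) ∧ (∀ j k, IsAlgebraic ℚ ((μ j).coeff k)) ∧ (∀ k, IsAlgebraic ℚ (μ₀.coeff k)) ∧ ∀ ϖ ∈ Set.Icc (0:ℝ) 1, (m₀ : ℝ) + ∑ i, (m i : ℝ) * (∫ z in Set.pi Set.univ (fun _ : Fin (n i) => Set.Icc (0:ℝ) 1), g i (ϖ • z)) = (ϖ - 1) * (μ₀.eval ϖ + ∑ j, (μ j).eval ϖ * (∫ z in Set.pi Set.univ (fun _ : Fin (d j) => Set.Icc (0:ℝ) 1), G j (ϖ • z))) := by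


  intro S n g U hg m m₀ hsum
  classical
  have h1I : (1:ℝ) ∈ Set.Icc (0:ℝ) 1 := ⟨zero_le_one, le_rfl⟩
  -- is the combination's dilation function that of two-variable x₀-EXACT RATIONAL data?
  by_cases hR : ∃ (P Q : Fin S → MvPolynomial (Fin 2) ℚ) (a b : ℚ), (a:ℝ) < 0 ∧ 1 < (b:ℝ) ∧
      (∀ i, ∀ p ∈ Set.pi Set.univ (fun _ : Fin 2 => Set.Ioo (a:ℝ) b), MvPolynomial.aeval p (Q i) ≠ 0) ∧
      ∀ ϖ ∈ Set.Icc (0:ℝ) 1, (m₀ : ℝ) + ∑ i, (m i : ℝ) *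
          (∫ z in Set.pi Set.univ (fun _ : Fin (n i) => Set.Icc (0:ℝ) 1), g i (ϖ • z)) =
        (m₀ : ℝ) + ∑ i, (m i : ℝ) * (∫ z in Set.pi Set.univ (fun _ : Fin 2 => Set.Icc (0:ℝ) 1),
          (MvPolynomial.aeval (ϖ • z) (MvPolynomial.pderiv 0 (P i)) * MvPolynomial.aeval (ϖ • z) (Q i) -
              MvPolynomial.aeval (ϖ • z) (P i) * MvPolynomial.aeval (ϖ • z) (MvPolynomial.pderiv 0 (Q i))) /
            (MvPolynomial.aeval (ϖ • z) (Q i)) ^ 2)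
  · obtain ⟨P, Q, a, b, ha, hb, hQ, hR⟩ := hR
    -- (S3⁗) Stokes descent: one-variable data + kernels
    obtain ⟨Kn, Kd, K, V, hKd, hVo, hVc, hKs, hKa, hid⟩ := h₈ S P Q a b ha hb hQ
    -- (S3‴) the one-variable rational data are complex Baker-sector data
    obtain ⟨ρ, A, p, q, γ, δ, hρs, hρa, hp, hq, hγ, hδ, hslit, hrepr⟩ := h₇ S Kn Kd a b ha hb hKd m m₀
    have hk1 : ∀ i, (∫ z in Set.pi Set.univ (fun _ : Fin 1 => Set.Icc (0:ℝ) 1),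
        Polynomial.aeval (((1:ℝ) • z) 0) (Kn i) / Polynomial.aeval (((1:ℝ) • z) 0) (Kd i)) =
        ∫ z in Set.pi Set.univ (fun _ : Fin 2 => Set.Icc (0:ℝ) 1),
          (MvPolynomial.aeval ((1:ℝ) • z) (MvPolynomial.pderiv 0 (P i)) * MvPolynomial.aeval ((1:ℝ) • z) (Q i) -
              MvPolynomial.aeval ((1:ℝ) • z) (P i) * MvPolynomial.aeval ((1:ℝ) • z) (MvPolynomial.pderiv 0 (Q i))) /
            (MvPolynomial.aeval ((1:ℝ) • z) (Q i)) ^ 2 := by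
      intro i
      rw [hid i 1 h1I]
      ring
    have h1 : (∫ z in Set.pi Set.univ (fun _ : Fin 1 => Set.Icc (0:ℝ) 1),
        (deriv ρ (((1:ℝ) • z) 0) + ∑ k, (γ k * (-p k + (p k ^ 2 + q k ^ 2) * (((1:ℝ) • z) 0)) + δ k * q k) /
          ((1 - p k * (((1:ℝ) • z) 0)) ^ 2 + (q k * (((1:ℝ) • z) 0)) ^ 2))) = 0 := by
      rw [← hrepr 1 h1I]
      simp only [hk1]
      rw [← hR 1 h1I]
      exact hsum
    -- (S3″) the complex Baker-sector lift for the one-variable part, one kernel on `[0,1]`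
    obtain ⟨K₀, V₀, hV₀o, hV₀c, hK₀s, hK₀a, hid₀⟩ := h₆ a b ha hb ρ hρs hρa A p q γ δ hp hq hγ hδ hslit h1
    -- (S4) every twisted-diagonal integral is one dilation function
    obtain ⟨G₀, V₀', hG₀, hG₀K⟩ := h₄ 1 K₀ V₀ hV₀o hV₀c hK₀s hK₀a
    have hGi : ∀ i, ∃ (G : (Fin (1 + 1) → ℝ) → ℝ) (V' : Set (Fin (1 + 1) → ℝ)),
        (IsOpen V' ∧ Set.pi Set.univ (fun _ : Fin (1 + 1) => Set.Icc (0:ℝ) 1) ⊆ V' ∧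
          Literature.NumberTheory.Transcendental.IsSemialgebraicFunOn ℚ V' G ∧ AnalyticOnNhd ℝ G V') ∧
        ∀ ϖ ∈ Set.Icc (0:ℝ) 1, (∫ y in Set.pi Set.univ (fun _ : Fin 1 => Set.Icc (0:ℝ) 1),
          K i (Matrix.vecCons ϖ (ϖ • y))) =
          ∫ y' in Set.pi Set.univ (fun _ : Fin (1 + 1) => Set.Icc (0:ℝ) 1), G (ϖ • y') :=
      fun i => h₄ 1 (K i) V hVo hVc (hKs i) (hKa i)
    choose G V' hG hGK using hGi
    refine ⟨S + 1, fun _ => 1 + 1,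
      fun j => Fin.cases (motive := fun _ => (Fin (1 + 1) → ℝ) → ℝ) G₀ G j,
      fun j => Fin.cases (motive := fun _ => Set (Fin (1 + 1) → ℝ)) V₀' V' j,
      fun j => Fin.cases (motive := fun _ => Polynomial ℝ) 1 (fun i => Polynomial.C (m i : ℝ)) j, 0,
      ?_, ?_, ?_, ?_⟩
    · intro j
      refine Fin.cases ?_ (fun i => ?_) j
      · simpa using hG₀
      · simpa using hG i
    · intro j k
      refine Fin.cases ?_ (fun i => ?_) j
      · simp only [Fin.cases_zero, Polynomial.coeff_one]
        split_ifs
        · exact isAlgebraic_one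
        · exact isAlgebraic_zero
      · simp only [Fin.cases_succ, Polynomial.coeff_C]
        split_ifs
        · simpa using isAlgebraic_algebraMap (R := ℚ) (A := ℝ) (m i : ℚ)
        · exact isAlgebraic_zero
    · intro k
      rw [Polynomial.coeff_zero]
      exact isAlgebraic_zero
    · intro ϖ hϖ
      rw [hR ϖ hϖ]
      have hsplit : (∑ i, (m i : ℝ) * ∫ z in Set.pi Set.univ (fun _ : Fin 2 => Set.Icc (0:ℝ) 1),
          (MvPolynomial.aeval (ϖ • z) (MvPolynomial.pderiv 0 (P i)) * MvPolynomial.aeval (ϖ • z) (Q i) -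
              MvPolynomial.aeval (ϖ • z) (P i) * MvPolynomial.aeval (ϖ • z) (MvPolynomial.pderiv 0 (Q i))) /
            (MvPolynomial.aeval (ϖ • z) (Q i)) ^ 2) =
          (∑ i, (m i : ℝ) * ∫ z in Set.pi Set.univ (fun _ : Fin 1 => Set.Icc (0:ℝ) 1),
            Polynomial.aeval ((ϖ • z) 0) (Kn i) / Polynomial.aeval ((ϖ • z) 0) (Kd i)) +
          (ϖ - 1) * ∑ i, (m i : ℝ) * ∫ y' in Set.pi Set.univ (fun _ : Fin (1 + 1) => Set.Icc (0:ℝ) 1),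
            G i (ϖ • y') := by
        rw [Finset.mul_sum, ← Finset.sum_add_distrib]
        refine Finset.sum_congr rfl fun i _ => ?_
        rw [hid i ϖ hϖ, hGK i ϖ hϖ]
        ring
      rw [hsplit, ← add_assoc, hrepr ϖ hϖ, hid₀ ϖ hϖ, hG₀K ϖ hϖ, Fin.sum_univ_succ]
      simp only [Fin.cases_zero, Fin.cases_succ, Polynomial.eval_one, Polynomial.eval_C,
        Polynomial.eval_zero, one_mul, zero_add]
      ring
  · exact DilationLiftAtOne_of_stubs''' h₁ h₂ h₃ h₄ h₅ h₆ h₇ S n g U hg m m₀ hsum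

/-- **Decomposition theorem with the Liouville stub (RESHAPE 5, lead c2).** If the integer
combination's dilation function is that of one-variable data in Liouville normal form, (S3⁵)+(S4)
settle it unconditionally; otherwise fall back to `DilationLiftAtOne_of_stubs''''`.
[cite: KontsevichZagier2001, §1.2] -/
theorem DilationLiftAtOne_of_stubs'''''
    (h₁ : ∀ (S : ℕ) (n : Fin S → ℕ) (g : (i : Fin S) → (Fin (n i) → ℝ) → ℝ) (U : (i : Fin S) → Set (Fin (n i) → ℝ)), (∀ i, IsOpen (U i) ∧ Set.pi Set.univ (fun _ : Fin (n i) => Set.Icc (0:ℝ) 1) ⊆ (U i) ∧ Literature.NumberTheory.Transcendental.IsSemialgebraicFunOn ℚ (U i) (g i) ∧ AnalyticOnNhd ℝ (g i) (U i)) → ∀ (m : Fin S → ℤ) (m₀ : ℤ), ∃ (N : ℕ) (h : (Fin N → ℝ) → ℝ) (W : Set (Fin N → ℝ)), (IsOpen W ∧ Set.pi Set.univ (fun _ : Fin N => Set.Icc (0:ℝ) 1) ⊆ W ∧ Literature.NumberTheory.Transcendental.IsSemialgebraicFunOn ℚ W h ∧ AnalyticOnNhd ℝ h W) ∧ ∀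 ϖ ∈ Set.Icc (0:ℝ) 1, (m₀ : ℝ) + ∑ i, (m i : ℝ) * (∫ z in Set.pi Set.univ (fun _ : Fin (n i) => Set.Icc (0:ℝ) 1), g i (ϖ • z)) = ∫ z in Set.pi Set.univ (fun _ : Fin N => Set.Icc (0:ℝ) 1), h (ϖ • z))
    (h₂ : ∀ (N : ℕ) (h : (Fin N → ℝ) → ℝ) (W : Set (Fin N → ℝ)), IsOpen W → Set.pi Set.univ (fun _ : Fin N => Set.Icc (0:ℝ) 1) ⊆ W → Literature.NumberTheory.Transcendental.IsSemialgebraicFunOn ℚ W h → AnalyticOnNhd ℝ h W → (∫ z in Set.pi Set.univ (fun _ : Fin N => Set.Icc (0:ℝ) 1), h ((1:ℝ) • z)) = 0 → ∃ (ε : ℝ) (d₁ : ℕ) (K₁ : (Fin (d₁ + 1) → ℝ) → ℝ) (V₁ : Set (Fin (d₁ + 1) → ℝ)), 0 < ε ∧ IsOpen V₁ ∧ (∀ ϖ ∈ Set.Ioc (1 - ε) 1, ∀ x ∈ Set.pi Set.univ (fun _ : Fin d₁ => Set.Icc (0:ℝ) 1), Matrix.vecCons ϖ x ∈ V₁) ∧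 Literature.NumberTheory.Transcendental.IsSemialgebraicFunOn ℚ V₁ K₁ ∧ AnalyticOnNhd ℝ K₁ V₁ ∧ ∀ ϖ ∈ Set.Ioc (1 - ε) 1, (∫ z in Set.pi Set.univ (fun _ : Fin N => Set.Icc (0:ℝ) 1), h (ϖ • z)) = (ϖ - 1) * ∫ y in Set.pi Set.univ (fun _ : Fin d₁ => Set.Icc (0:ℝ) 1), K₁ (Matrix.vecCons ϖ (ϖ • y)))
    (h₃ : ∀ (N : ℕ) (h : (Fin N → ℝ) → ℝ) (W : Set (Fin N → ℝ)), IsOpen W → Set.pi Set.univ (fun _ : Fin N => Set.Icc (0:ℝ) 1) ⊆ W → Literature.NumberTheory.Transcendental.IsSemialgebraicFunOn ℚ W h → AnalyticOnNhd ℝ h W → ∀ (ε : ℝ) (d₁ : ℕ) (K₁ : (Fin (d₁ + 1) → ℝ) → ℝ) (V₁ : Set (Fin (d₁ + 1) → ℝ)), 0 < ε → IsOpen V₁ → (∀ ϖ ∈ Set.Ioc (1 - ε) 1, ∀ x ∈ Set.pi Set.univ (fun _ : Fin d₁ => Set.Icc (0:ℝ) 1), Matrix.vecCons ϖ x ∈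 V₁) → Literature.NumberTheory.Transcendental.IsSemialgebraicFunOn ℚ V₁ K₁ → AnalyticOnNhd ℝ K₁ V₁ → (∀ ϖ ∈ Set.Ioc (1 - ε) 1, (∫ z in Set.pi Set.univ (fun _ : Fin N => Set.Icc (0:ℝ) 1), h (ϖ • z)) = (ϖ - 1) * ∫ y in Set.pi Set.univ (fun _ : Fin d₁ => Set.Icc (0:ℝ) 1), K₁ (Matrix.vecCons ϖ (ϖ • y))) → ∃ (d : ℕ) (K : (Fin (d + 1) → ℝ) → ℝ) (V : Set (Fin (d + 1) → ℝ)), IsOpen V ∧ (∀ ϖ ∈ Set.Icc (0:ℝ) 1, ∀ x ∈ Set.pi Set.univ (fun _ : Fin d => Set.Icc (0:ℝ) 1), Matrix.vecCons ϖ x ∈ V) ∧ Literature.NumberTheory.Transcendental.IsSemialgebraicFunOn ℚ V K ∧ AnalyticOnNhd ℝ K V ∧ ∀ ϖ ∈ Set.Icc (0:ℝ) 1, (∫ z in Set.pi Set.univ (fun _ : Fin N => Set.Icc (0:ℝ) 1), h (ϖ • z)) = (ϖ - 1) * ∫ y in Set.pi Set.univ (fun _ : Fin d => Set.Icc (0:ℝ)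 1), K (Matrix.vecCons ϖ (ϖ • y)))
    (h₄ : ∀ (d : ℕ) (K : (Fin (d + 1) → ℝ) → ℝ) (V : Set (Fin (d + 1) → ℝ)), IsOpen V → (∀ ϖ ∈ Set.Icc (0:ℝ) 1, ∀ x ∈ Set.pi Set.univ (fun _ : Fin d => Set.Icc (0:ℝ) 1), Matrix.vecCons ϖ x ∈ V) → Literature.NumberTheory.Transcendental.IsSemialgebraicFunOn ℚ V K → AnalyticOnNhd ℝ K V → ∃ (G : (Fin (d + 1) → ℝ) → ℝ) (V' : Set (Fin (d + 1) → ℝ)), (IsOpen V' ∧ Set.pi Set.univ (fun _ : Fin (d + 1) => Set.Icc (0:ℝ) 1) ⊆ V' ∧ Literature.NumberTheory.Transcendental.IsSemialgebraicFunOn ℚ V' G ∧ AnalyticOnNhd ℝ G V') ∧ ∀ ϖ ∈ Set.Icc (0:ℝ) 1, (∫ y in Set.pi Set.univ (fun _ : Fin d => Set.Icc (0:ℝ) 1), K (Matrix.vecCons ϖ (ϖ • y))) = ∫ y' in Set.pi Set.univ (fun _ : Fin (d + 1) => Set.Icc (0:ℝ) 1), G (ϖ • y'))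
    (h₅ : ∀ (a b : ℝ), a < 0 → 1 < b → ∀ (ρ : ℝ → ℝ), Literature.NumberTheory.Transcendental.IsSemialgebraicFunOn ℚ {t : Fin 1 → ℝ | t 0 ∈ Set.Ioo a b} (fun t => ρ (t 0)) → (∀ x ∈ Set.Ioo a b, AnalyticAt ℝ ρ x) → ∀ (A : ℕ) (α c : Fin A → ℝ), (∀ k, IsAlgebraic ℚ (α k)) → (∀ k, IsAlgebraic ℚ (c k)) → (∀ k, α k ≤ a ∨ b ≤ α k) → (∫ z in Set.pi Set.univ (fun _ : Fin 1 => Set.Icc (0:ℝ) 1), (deriv ρ (((1:ℝ) • z) 0) + ∑ k, c k / (((1:ℝ) • z) 0 - α k))) = 0 → ∃ (K : (Fin 2 → ℝ) → ℝ) (V : Set (Fin 2 → ℝ)), IsOpen V ∧ (∀ ϖ ∈ Set.Icc (0:ℝ) 1, ∀ x ∈ Set.pi Set.univ (fun _ : Fin 1 => Set.Icc (0:ℝ) 1), Matrix.vecCons ϖ x ∈ V) ∧ Literature.NumberTheory.Transcendental.IsSemialgebraicFunOn ℚ V K ∧ AnalyticOnNhd ℝ K V ∧ ∀ ϖ ∈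 Set.Icc (0:ℝ) 1, (∫ z in Set.pi Set.univ (fun _ : Fin 1 => Set.Icc (0:ℝ) 1), (deriv ρ ((ϖ • z) 0) + ∑ k, c k / ((ϖ • z) 0 - α k))) = (ϖ - 1) * ∫ y in Set.pi Set.univ (fun _ : Fin 1 => Set.Icc (0:ℝ) 1), K (Matrix.vecCons ϖ (ϖ • y)))
    (h₆ : ∀ (a b : ℝ), a < 0 → 1 < b → ∀ (ρ : ℝ → ℝ), Literature.NumberTheory.Transcendental.IsSemialgebraicFunOn ℚ {t : Fin 1 → ℝ | t 0 ∈ Set.Ioo a b} (fun t => ρ (t 0)) → (∀ x ∈ Set.Ioo a b, AnalyticAt ℝ ρ x) → ∀ (A : ℕ) (p q γ δ : Fin A → ℝ), (∀ k, IsAlgebraic ℚ (p k)) → (∀ k, IsAlgebraic ℚ (q k)) → (∀ k, IsAlgebraic ℚ (γ k)) → (∀ k, IsAlgebraic ℚ (δ k)) → (∀ k, ∀ x ∈ Set.Ioo a b, 0 < 1 - p k * x ∨ q k * x ≠ 0) → (∫ z in Set.pi Set.univ (fun _ : Fin 1 => Set.Icc (0:ℝ) 1), (deriv ρ (((1:ℝ)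 • z) 0) + ∑ k, (γ k * (-p k + (p k ^ 2 + q k ^ 2) * (((1:ℝ) • z) 0)) + δ k * q k) / ((1 - p k * (((1:ℝ) • z) 0)) ^ 2 + (q k * (((1:ℝ) • z) 0)) ^ 2))) = 0 → ∃ (K : (Fin 2 → ℝ) → ℝ) (V : Set (Fin 2 → ℝ)), IsOpen V ∧ (∀ ϖ ∈ Set.Icc (0:ℝ) 1, ∀ x ∈ Set.pi Set.univ (fun _ : Fin 1 => Set.Icc (0:ℝ) 1), Matrix.vecCons ϖ x ∈ V) ∧ Literature.NumberTheory.Transcendental.IsSemialgebraicFunOn ℚ V K ∧ AnalyticOnNhd ℝ K V ∧ ∀ ϖ ∈ Set.Icc (0:ℝ) 1, (∫ z in Set.pi Set.univ (fun _ : Fin 1 => Set.Icc (0:ℝ) 1), (deriv ρ ((ϖ • z) 0) + ∑ k, (γ k * (-p k + (p k ^ 2 + q k ^ 2) * ((ϖ • z) 0)) + δ k * q k) / ((1 - p k * ((ϖ • z) 0)) ^ 2 + (q k * ((ϖ • z) 0)) ^ 2))) = (ϖ - 1) * ∫ y in Set.pi Set.univ (fun _ : Fin 1 => Set.Icc (0:ℝ)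 1), K (Matrix.vecCons ϖ (ϖ • y)))
    (h₇ : ∀ (S : ℕ) (P Q : Fin S → Polynomial ℚ) (a b : ℚ), (a:ℝ) < 0 → 1 < (b:ℝ) → (∀ i, ∀ x ∈ Set.Ioo (a:ℝ) b, Polynomial.aeval x (Q i) ≠ 0) → ∀ (m : Fin S → ℤ) (m₀ : ℤ), ∃ (ρ : ℝ → ℝ) (A : ℕ) (p q γ δ : Fin A → ℝ), Literature.NumberTheory.Transcendental.IsSemialgebraicFunOn ℚ {t : Fin 1 → ℝ | t 0 ∈ Set.Ioo (a:ℝ) b} (fun t => ρ (t 0)) ∧ (∀ x ∈ Set.Ioo (a:ℝ) b, AnalyticAt ℝ ρ x) ∧ (∀ k, IsAlgebraic ℚ (p k)) ∧ (∀ k, IsAlgebraic ℚ (q k)) ∧ (∀ k, IsAlgebraic ℚ (γ k)) ∧ (∀ k, IsAlgebraic ℚ (δ k)) ∧ (∀ k, ∀ x ∈ Set.Ioo (a:ℝ) b, 0 < 1 - p k * x ∨ q k * x ≠ 0) ∧ ∀ ϖ ∈ Set.Icc (0:ℝ) 1, (m₀ : ℝ) + ∑ i, (m i : ℝ) * (∫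 z in Set.pi Set.univ (fun _ : Fin 1 => Set.Icc (0:ℝ) 1), Polynomial.aeval ((ϖ • z) 0) (P i) / Polynomial.aeval ((ϖ • z) 0) (Q i)) = ∫ z in Set.pi Set.univ (fun _ : Fin 1 => Set.Icc (0:ℝ) 1), (deriv ρ ((ϖ • z) 0) + ∑ k, (γ k * (-p k + (p k ^ 2 + q k ^ 2) * ((ϖ • z) 0)) + δ k * q k) / ((1 - p k * ((ϖ • z) 0)) ^ 2 + (q k * ((ϖ • z) 0)) ^ 2)))
    (h₈ : ∀ (S : ℕ) (P Q : Fin S → MvPolynomial (Fin 2) ℚ) (a b : ℚ), (a:ℝ) < 0 → 1 < (b:ℝ) → (∀ i, ∀ p ∈ Set.pi Set.univ (fun _ : Fin 2 => Set.Ioo (a:ℝ) b), MvPolynomial.aeval p (Q i) ≠ 0) → ∃ (Kn Kd : Fin S → Polynomial ℚ) (K : Fin S → (Fin 2 → ℝ) → ℝ) (V : Set (Fin 2 → ℝ)), (∀ i, ∀ x ∈ Set.Ioo (a:ℝ) b, Polynomial.aeval x (Kd i) ≠ 0) ∧ IsOpen V ∧ (∀ ϖ ∈ Set.Icc (0:ℝ)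 1, ∀ x ∈ Set.pi Set.univ (fun _ : Fin 1 => Set.Icc (0:ℝ) 1), Matrix.vecCons ϖ x ∈ V) ∧ (∀ i, Literature.NumberTheory.Transcendental.IsSemialgebraicFunOn ℚ V (K i)) ∧ (∀ i, AnalyticOnNhd ℝ (K i) V) ∧ ∀ i, ∀ ϖ ∈ Set.Icc (0:ℝ) 1, (∫ z in Set.pi Set.univ (fun _ : Fin 2 => Set.Icc (0:ℝ) 1), (MvPolynomial.aeval (ϖ • z) (MvPolynomial.pderiv 0 (P i)) * MvPolynomial.aeval (ϖ • z) (Q i) - MvPolynomial.aeval (ϖ • z) (P i) * MvPolynomial.aeval (ϖ • z) (MvPolynomial.pderiv 0 (Q i))) / (MvPolynomial.aeval (ϖ • z) (Q i)) ^ 2) = (∫ z in Set.pi Set.univ (fun _ : Fin 1 => Set.Icc (0:ℝ) 1), Polynomial.aeval ((ϖ • z) 0) (Kn i) / Polynomial.aeval ((ϖ • z) 0) (Kd i)) + (ϖ - 1) * ∫ y in Set.pi Set.univ (fun _ : Fin 1 => Set.Icc (0:ℝ) 1), K i (Matrix.vecCons ϖ (ϖ • y)))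
    (h₉ : ∀ (a b : ℝ), a < 0 → 1 < b → ∀ (N : ℝ → ℝ), Literature.NumberTheory.Transcendental.IsSemialgebraicFunOn ℚ {t : Fin 1 → ℝ | t 0 ∈ Set.Ioo a b} (fun t => N (t 0)) → (∀ x ∈ Set.Ioo a b, AnalyticAt ℝ N x) → ∀ (A : ℕ) (u v : Fin A → ℝ → ℝ), (∀ k, Literature.NumberTheory.Transcendental.IsSemialgebraicFunOn ℚ {t : Fin 1 → ℝ | t 0 ∈ Set.Ioo a b} (fun t => u k (t 0))) → (∀ k, Literature.NumberTheory.Transcendental.IsSemialgebraicFunOn ℚ {t : Fin 1 → ℝ | t 0 ∈ Set.Ioo a b} (fun t => v k (t 0))) → (∀ k, ∀ x ∈ Set.Ioo a b, AnalyticAt ℝ (u k) x) → (∀ k, ∀ x ∈ Set.Ioo a b, AnalyticAt ℝ (v k) x) → (∀ k, ∀ x ∈ Set.Ioo a b, 0 < u k x ∨ v k x ≠ 0) → ∀ (γ δ : Fin A → ℝ), (∀ k, IsAlgebraic ℚ (γ k)) → (∀ k, IsAlgebraic ℚ (δ k)) → (∫ z in Set.pi Set.univ (fun _ : Fin 1 =>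 Set.Icc (0:ℝ) 1), (deriv N (((1:ℝ) • z) 0) + ∑ k, (γ k * ((deriv (u k) (((1:ℝ) • z) 0) * u k (((1:ℝ) • z) 0) + deriv (v k) (((1:ℝ) • z) 0) * v k (((1:ℝ) • z) 0)) / (u k (((1:ℝ) • z) 0) ^ 2 + v k (((1:ℝ) • z) 0) ^ 2)) - δ k * ((deriv (v k) (((1:ℝ) • z) 0) * u k (((1:ℝ) • z) 0) - deriv (u k) (((1:ℝ) • z) 0) * v k (((1:ℝ) • z) 0)) / (u k (((1:ℝ) • z) 0) ^ 2 + v k (((1:ℝ) • z) 0) ^ 2))))) = 0 → ∃ (K : (Fin 2 → ℝ) → ℝ) (V : Set (Fin 2 → ℝ)), IsOpen V ∧ (∀ ϖ ∈ Set.Icc (0:ℝ) 1, ∀ x ∈ Set.pi Set.univ (fun _ : Fin 1 => Set.Icc (0:ℝ) 1), Matrix.vecCons ϖ x ∈ V) ∧ Literature.NumberTheory.Transcendental.IsSemialgebraicFunOn ℚ V K ∧ AnalyticOnNhd ℝ K V ∧ ∀ ϖ ∈ Set.Icc (0:ℝ) 1, (∫ z in Set.pi Set.univ (fun _ : Fin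 1 => Set.Icc (0:ℝ) 1), (deriv N ((ϖ • z) 0) + ∑ k, (γ k * ((deriv (u k) ((ϖ • z) 0) * u k ((ϖ • z) 0) + deriv (v k) ((ϖ • z) 0) * v k ((ϖ • z) 0)) / (u k ((ϖ • z) 0) ^ 2 + v k ((ϖ • z) 0) ^ 2)) - δ k * ((deriv (v k) ((ϖ • z) 0) * u k ((ϖ • z) 0) - deriv (u k) ((ϖ • z) 0) * v k ((ϖ • z) 0)) / (u k ((ϖ • z) 0) ^ 2 + v k ((ϖ • z) 0) ^ 2))))) = (ϖ - 1) * ∫ y in Set.pi Set.univ (fun _ : Fin 1 => Set.Icc (0:ℝ) 1), K (Matrix.vecCons ϖ (ϖ • y))) :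
    ∀ (S : ℕ) (n : Fin S → ℕ) (g : (i : Fin S) → (Fin (n i) → ℝ) → ℝ) (U : (i : Fin S) → Set (Fin (n i) → ℝ)), (∀ i, IsOpen (U i) ∧ Set.pi Set.univ (fun _ : Fin (n i) => Set.Icc (0:ℝ) 1) ⊆ (U i) ∧ Literature.NumberTheory.Transcendental.IsSemialgebraicFunOn ℚ (U i) (g i) ∧ AnalyticOnNhd ℝ (g i) (U i)) → ∀ (m : Fin S → ℤ) (m₀ : ℤ), (m₀ : ℝ) + ∑ i, (m i : ℝ) * (∫ z in Set.pi Set.univ (fun _ : Fin (n i) => Set.Icc (0:ℝ) 1), g i ((1:ℝ) • z)) = 0 → ∃ (T : ℕ) (d : Fin T → ℕ) (G : (j : Fin T) → (Fin (d j) → ℝ) → ℝ) (V : (j : Fin T) → Set (Fin (d j) → ℝ)) (μ : Fin T → Polynomial ℝ) (μ₀ : Polynomial ℝ), (∀ j, IsOpen (V j) ∧ Set.pi Set.univ (fun _ : Fin (d j) => Set.Icc (0:ℝ) 1) ⊆ (V j) ∧ Literature.NumberTheory.Transcendental.IsSemialgebraicFunOn ℚ (V j) (G j) ∧ AnalyticOnNhd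 ℝ (G j) (V j)) ∧ (∀ j k, IsAlgebraic ℚ ((μ j).coeff k)) ∧ (∀ k, IsAlgebraic ℚ (μ₀.coeff k)) ∧ ∀ ϖ ∈ Set.Icc (0:ℝ) 1, (m₀ : ℝ) + ∑ i, (m i : ℝ) * (∫ z in Set.pi Set.univ (fun _ : Fin (n i) => Set.Icc (0:ℝ) 1), g i (ϖ • z)) = (ϖ - 1) * (μ₀.eval ϖ + ∑ j, (μ j).eval ϖ * (∫ z in Set.pi Set.univ (fun _ : Fin (d j) => Set.Icc (0:ℝ) 1), G j (ϖ • z))) := by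



  intro S n g U hg m m₀ hsum
  classical
  -- is the combination's dilation function that of one-variable data in LIOUVILLE normal form?
  by_cases hR : ∃ (a b : ℝ) (N : ℝ → ℝ) (A : ℕ) (u v : Fin A → ℝ → ℝ) (γ δ : Fin A → ℝ),
      a < 0 ∧ 1 < b ∧
      Literature.NumberTheory.Transcendental.IsSemialgebraicFunOn ℚ {t : Fin 1 → ℝ | t 0 ∈ Set.Ioo a b} (fun t => N (t 0)) ∧
      (∀ x ∈ Set.Ioo a b, AnalyticAt ℝ N x) ∧
      (∀ k, Literature.NumberTheory.Transcendental.IsSemialgebraicFunOn ℚ {t : Fin 1 → ℝ | t 0 ∈ Set.Ioo a b} (fun t => u k (t 0))) ∧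
      (∀ k, Literature.NumberTheory.Transcendental.IsSemialgebraicFunOn ℚ {t : Fin 1 → ℝ | t 0 ∈ Set.Ioo a b} (fun t => v k (t 0))) ∧
      (∀ k, ∀ x ∈ Set.Ioo a b, AnalyticAt ℝ (u k) x) ∧ (∀ k, ∀ x ∈ Set.Ioo a b, AnalyticAt ℝ (v k) x) ∧
      (∀ k, ∀ x ∈ Set.Ioo a b, 0 < u k x ∨ v k x ≠ 0) ∧
      (∀ k, IsAlgebraic ℚ (γ k)) ∧ (∀ k, IsAlgebraic ℚ (δ k)) ∧
      ∀ ϖ ∈ Set.Icc (0:ℝ) 1, (m₀ : ℝ) + ∑ i, (m i : ℝ) *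
          (∫ z in Set.pi Set.univ (fun _ : Fin (n i) => Set.Icc (0:ℝ) 1), g i (ϖ • z)) =
        ∫ z in Set.pi Set.univ (fun _ : Fin 1 => Set.Icc (0:ℝ) 1),
          (deriv N ((ϖ • z) 0) + ∑ k,
            (γ k * ((deriv (u k) ((ϖ • z) 0) * u k ((ϖ • z) 0) + deriv (v k) ((ϖ • z) 0) * v k ((ϖ • z) 0)) /
                (u k ((ϖ • z) 0) ^ 2 + v k ((ϖ • z) 0) ^ 2)) -
              δ k * ((deriv (v k) ((ϖ • z) 0) * u k ((ϖ • z) 0) - deriv (u k) ((ϖ • z) 0) * v k ((ϖ • z) 0)) /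
                (u k ((ϖ • z) 0) ^ 2 + v k ((ϖ • z) 0) ^ 2))))
  · obtain ⟨a, b, N, A, u, v, γ, δ, ha, hb, hNs, hNa, hus, hvs, hua, hva, hslit, hγ, hδ, hrepr⟩ := hR
    have h1 : (∫ z in Set.pi Set.univ (fun _ : Fin 1 => Set.Icc (0:ℝ) 1),
        (deriv N (((1:ℝ) • z) 0) + ∑ k,
          (γ k * ((deriv (u k) (((1:ℝ) • z) 0) * u k (((1:ℝ) • z) 0) + deriv (v k) (((1:ℝ) • z) 0) * v k (((1:ℝ) • z) 0)) /
              (u k (((1:ℝ) • z) 0) ^ 2 + v k (((1:ℝ) • z) 0) ^ 2)) -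
            δ k * ((deriv (v k) (((1:ℝ) • z) 0) * u k (((1:ℝ) • z) 0) - deriv (u k) (((1:ℝ) • z) 0) * v k (((1:ℝ) • z) 0)) /
              (u k (((1:ℝ) • z) 0) ^ 2 + v k (((1:ℝ) • z) 0) ^ 2))))) = 0 := by
      rw [← hrepr 1 ⟨zero_le_one, le_rfl⟩]
      exact hsum
    -- (S3⁵) the Liouville-sector lift, one kernel on `[0,1]`
    obtain ⟨K, V, hVo, hVc, hKs, hKa, hid⟩ :=
      h₉ a b ha hb N hNs hNa A u v hus hvs hua hva hslit γ δ hγ hδ h1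
    -- (S4) the twisted-diagonal integral is one dilation function `v_G`
    obtain ⟨G, V', hG, hGK⟩ := h₄ 1 K V hVo hVc hKs hKa
    refine ⟨1, fun _ => 1 + 1, fun _ => G, fun _ => V', fun _ => 1, 0, fun _ => hG, ?_, ?_, ?_⟩
    · intro j k
      rw [Polynomial.coeff_one]
      split_ifs
      · exact isAlgebraic_one
      · exact isAlgebraic_zero
    · intro k
      rw [Polynomial.coeff_zero]
      exact isAlgebraic_zero
    · intro ϖ hϖ
      rw [hrepr ϖ hϖ, hid ϖ hϖ, hGK ϖ hϖ]
      simp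
  · exact DilationLiftAtOne_of_stubs'''' h₁ h₂ h₃ h₄ h₅ h₆ h₇ h₈ S n g U hg m m₀ hsum

/-- **The crux from the four registered stubs, BY NAME** (the skeleton theorem audited by
`ledger skeleton check`). Status after wave 1 (lead c1, 2026-08-17): `stub_singleGenerator`,
`stub_localPurityAtOne`, `stub_twistedDiagonal` are LANDED (Theorems files
`LiftingCriteriaDilationLiftAtOne{SingleGenerator,LocalPurityAtOne,TwistedDiagonal}.lean`,
p147156 / p147743 / p147188) and are plugged in above by name; the only remaining `sorry` is
`stub_glueAtOne` (the bet, crux-equivalent). [cite: KontsevichZagier2001, §1.2] -/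
theorem DilationLiftAtOne_of : DilationLiftAtOne :=
  DilationLiftAtOne_of_stubs''''' stub_singleGenerator stub_localPurityAtOne stub_glueAtOne
    stub_twistedDiagonal stub_bakerSectorReal stub_bakerSectorComplex stub_dimOneRational
    stub_dimTwoStokesRational stub_liouvilleSector

end Summit.KontsevichZagierPeriods.KontsevichZagierPeriods.Cruxes.DilationLiftAtOne.Birth
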